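import Literature.NumberTheory.LFunctions.MatomakiRadziwillTaoTheoremA2
import Literature.NumberTheory.LFunctions.MatomakiRadziwillTaoMinorArc
import Literature.NumberTheory.LFunctions.TaoLogElliottProp24
import Literature.NumberTheory.LFunctions.TaoLogElliottUnimodular
import Mathlib.NumberTheory.DirichletCharacter.Orthogonality
import HarnessLib

/-!
# Matomäki–Radziwiłł–Tao 2015, §4: the major arc estimate (from Theorem A.2)

K. Matomäki, M. Radziwiłł, T. Tao, *An averaged form of Chowla's conjecture*, Algebra & Number
Theory **9** (2015), §4 "Proof of major arc estimate".  Everything in this file is PROVED, from the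
named fact `Literature.NumberTheory.LFunctions.MatomakiRadziwillTao2015_theoremA2` (Theorem A.2) via its discrete corollary
`Literature.NumberTheory.LFunctions.MRT2015.theoremA2_discrete`.

The argument is the printed one, in discrete form (integer `x`, windows `x < d m ≤ x + L`):
removal of the twist `e(βm)`, `|β| ≤ W/(qL)`, by partial summation (`winL1_twist_le`, the
"fundamental theorem of calculus" step of §4), splitting into residue classes `b (mod q)`
(`winL1_residue_le`), passage from the class `b = d₀ b₀ (mod q = d₀ q₀)` to `m = d₀ m'`,
`m' ≡ b₀ (mod q₀)` (`sum_filter_mod_eq_sum_div`), expansion of the primitive class `b₀ (mod q₀)`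
in Dirichlet characters (`norm_sum_filter_mod_le_sum_chars`), dyadic decomposition in the height,
Cauchy–Schwarz and Theorem A.2 on each dyadic block (`winL1_typical_char_le`), with the
non-pretentiousness of `g χ̄` at the dyadic heights deduced from that of `g` at height `X`
(`minPretentiousDistSq_twistChar_ge`).

Main statement: `Literature.NumberTheory.LFunctions.MRT2015.majorArc_le` — the bound
`∑_{x ≤ X₃} |∑_{x < dm ≤ x+L, m ∈ 𝒮'} g(m) e(αm)| ≤ C L X₃ / (d^{3/4} W^{1/4})`
for `α = a/q + β`, `q ≤ W`, `|β| ≤ W/(qL)` (the major arc case of [MRT2015, Prop. 2.4], in the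
parametrisation used in `MatomakiRadziwillTaoKeyEstimate.lean`).

## References
* [MRT2015] Matomäki–Radziwiłł–Tao, Algebra & Number Theory 9 (2015), §4. [cite: MatomakiRadziwillTao2015, §4]

## Design choices
* The unit-scale window family `winL1 c t Y = ∑_{y ≤ Y} |∑_{y < m ≤ y + t} c(m)|` is the
  discrete stand-in for `∫ |∑_{y ≤ m ≤ y + H'} …| dy`; rescaling `y ↦ ⌊y/D⌋` costs a factor `D`
  and produces the two window lengths `⌊t/D⌋, ⌊t/D⌋ + 1` (`sum_norm_win_div_le`).
-/

noncomputable section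

open Finset Real
open scoped Classical FourierTransform

namespace Literature.NumberTheory.LFunctions

open Sieve (SieveIntervalSystem minPretentiousDistSq minPretentiousDistSq_nonneg)

namespace MRT2015

open Sieve.Vinogradov

/-! ### Window families and rescaling -/

/-- `winL1 c t Y = ∑_{y ≤ Y} |∑_{y < m ≤ y + t} c(m)|`. [cite: MatomakiRadziwillTao2015, §4] -/
def winL1 (c : ℕ → ℂ) (t Y : ℕ) : ℝ := ∑ y ∈ range (Y + 1), ‖∑ m ∈ Ioc y (y + t), c m‖

/-- `winL1 ≥ 0`. [folklore] -/
theorem winL1_nonneg (c : ℕ → ℂ) (t Y : ℕ) : 0 ≤ winL1 c t Y :=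
  Finset.sum_nonneg fun _ _ => norm_nonneg _

/-- Trivial bound `winL1 c t Y ≤ (Y + 1) t` for `1`-bounded `c`. [folklore] -/
theorem winL1_le_trivial {c : ℕ → ℂ} (hc : ∀ m, ‖c m‖ ≤ 1) (t Y : ℕ) :
    winL1 c t Y ≤ (Y + 1) * t := by
  unfold winL1
  calc ∑ y ∈ range (Y + 1), ‖∑ m ∈ Ioc y (y + t), c m‖ ≤ ∑ y ∈ range (Y + 1), (t : ℝ) := by
        refine Finset.sum_le_sum fun y _ => (norm_sum_le _ _).trans ?_
        calc ∑ m ∈ Ioc y (y + t), ‖c m‖ ≤ ∑ m ∈ Ioc y (y + t), (1 : ℝ) :=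
              Finset.sum_le_sum fun m _ => hc m
          _ = t := by simp
    _ = (Y + 1) * t := by rw [Finset.sum_const, card_range, nsmul_eq_mul]; push_cast; ring

/-- Monotonicity of `winL1` in `Y`. [folklore] -/
theorem winL1_mono {c : ℕ → ℂ} {t Y Y' : ℕ} (h : Y ≤ Y') : winL1 c t Y ≤ winL1 c t Y' := by
  unfold winL1
  exact Finset.sum_le_sum_of_subset_of_nonneg (Finset.range_subset_range.mpr (by omega))
    fun _ _ _ => norm_nonneg _

/-- **Rescaling the windows**: `∑_{y ≤ Y} |∑_{y/D < m ≤ (y+t)/D} c(m)|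
≤ D (winL1 c ⌊t/D⌋ ⌊Y/D⌋ + winL1 c (⌊t/D⌋+1) ⌊Y/D⌋)`; each `y' = ⌊y/D⌋` has at most `D`
preimages and `⌊(y+t)/D⌋ ∈ {y' + ⌊t/D⌋, y' + ⌊t/D⌋ + 1}`. [cite: MatomakiRadziwillTao2015, §4 (changes of variables `y = x/d₁`)] -/
theorem sum_norm_win_div_le (c : ℕ → ℂ) {D : ℕ} (hD : 0 < D) (t Y : ℕ) :
    ∑ y ∈ range (Y + 1), ‖∑ m ∈ Ioc (y / D) ((y + t) / D), c m‖ ≤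
      D * (winL1 c (t / D) (Y / D) + winL1 c (t / D + 1) (Y / D)) := by
  set F : ℕ → ℝ := fun y' =>
    ‖∑ m ∈ Ioc y' (y' + t / D), c m‖ + ‖∑ m ∈ Ioc y' (y' + (t / D + 1)), c m‖ with hF
  have hterm : ∀ y, ‖∑ m ∈ Ioc (y / D) ((y + t) / D), c m‖ ≤ F (y / D) := by
    intro y
    have h1 : y / D + t / D ≤ (y + t) / D := Nat.add_div_le_add_div y t D
    have h2 : (y + t) / D ≤ y / D + t / D + 1 := add_div_le y t D
    rcases Nat.eq_or_lt_of_le h1 with h | h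
    · rw [← h, hF]; dsimp only
      linarith [norm_nonneg (∑ m ∈ Ioc (y / D) (y / D + (t / D + 1)), c m)]
    · have h3 : (y + t) / D = y / D + (t / D + 1) := by omega
      rw [h3, hF]; dsimp only
      linarith [norm_nonneg (∑ m ∈ Ioc (y / D) (y / D + t / D), c m)]
  have hmaps : ∀ y ∈ range (Y + 1), y / D ∈ range (Y / D + 1) := by
    intro y hy
    rw [Finset.mem_range] at hy ⊢
    exact Nat.lt_succ_of_le (Nat.div_le_div_right (by omega))
  calc ∑ y ∈ range (Y + 1), ‖∑ m ∈ Ioc (y / D) ((y + t) / D), c m‖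
      ≤ ∑ y ∈ range (Y + 1), F (y / D) := Finset.sum_le_sum fun y _ => hterm y
    _ = ∑ y' ∈ range (Y / D + 1), ∑ y ∈ (range (Y + 1)).filter (fun y => y / D = y'), F (y / D) :=
        (Finset.sum_fiberwise_of_maps_to hmaps _).symm
    _ = ∑ y' ∈ range (Y / D + 1), #((range (Y + 1)).filter (fun y => y / D = y')) * F y' := by
        refine Finset.sum_congr rfl fun y' _ => ?_
        rw [Finset.sum_congr rfl (g := fun _ => F y') (fun y hy => by
          rw [(Finset.mem_filter.mp hy).2]), Finset.sum_const, nsmul_eq_mul]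
    _ ≤ ∑ y' ∈ range (Y / D + 1), D * F y' := by
        refine Finset.sum_le_sum fun y' _ => ?_
        have hF0 : 0 ≤ F y' := by rw [hF]; positivity
        refine mul_le_mul_of_nonneg_right ?_ hF0
        have : #((range (Y + 1)).filter (fun y => y / D = y')) ≤ #(Ico (D * y') (D * y' + D)) := by
          refine Finset.card_le_card fun y hy => ?_
          rw [Finset.mem_filter] at hy
          rw [Finset.mem_Ico]
          have := Nat.div_mul_le_self y D
          have h2 := Nat.lt_div_mul_add (a := y) hD
          rw [hy.2] at this h2
          constructor <;> linarith [mul_comm D y']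
        rw [Nat.card_Ico] at this
        have e : D * y' + D - D * y' = D := by omega
        rw [e] at this
        exact_mod_cast this
    _ = D * (winL1 c (t / D) (Y / D) + winL1 c (t / D + 1) (Y / D)) := by
        rw [← Finset.mul_sum, winL1, winL1, ← Finset.sum_add_distrib]

/-! ### Removing a small twist by partial summation -/

/-- `|e(u + β) - e(u)| ≤ 2π|β|`. [folklore] -/
theorem norm_fourierChar_add_sub_le (u β : ℝ) : ‖(𝐞 (u + β) : ℂ) - 𝐞 u‖ ≤ 2 * π * |β| := by
  rw [← fourierChar_mul_fourierChar, ← mul_sub_one, norm_mul, norm_fourierChar, one_mul,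
    norm_fourierChar_sub_one]
  have := Real.abs_sin_le_abs (x := π * β)  -- `|sin x| ≤ |x|`
  rw [abs_mul, abs_of_pos Real.pi_pos] at this
  linarith

/-- Abel summation for a window: with `S_j = ∑_{y < m ≤ y + j} c(m)`,
`∑_{y < m ≤ y+t} c(m) e(βm) = S_t e(β(y+t)) - ∑_{j < t} S_j (e(β(y+j+1)) - e(β(y+j)))`. [folklore] -/
theorem sum_Ioc_twist_eq (c : ℕ → ℂ) (β : ℝ) (y t : ℕ) :
    ∑ m ∈ Ioc y (y + t), c m * (𝐞 (β * m) : ℂ) =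
      (∑ m ∈ Ioc y (y + t), c m) * (𝐞 (β * ((y + t : ℕ) : ℝ)) : ℂ) -
        ∑ j ∈ range t, (∑ m ∈ Ioc y (y + j), c m) *
          ((𝐞 (β * ((y + j + 1 : ℕ) : ℝ)) : ℂ) - 𝐞 (β * ((y + j : ℕ) : ℝ))) := by
  induction t with
  | zero => simp
  | succ t ih =>
    rw [show y + (t + 1) = y + t + 1 by ring, Finset.sum_Ioc_succ_top (by omega), ih,
      Finset.sum_range_succ, Finset.sum_Ioc_succ_top (by omega)]
    have e : y + t + 1 = y + (t + 1) := by ring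
    simp only [e]
    ring

/-- **Removing the twist** ([MRT2015, §4], first display): for `|β| ≤ B`,
`winL1 (c · e(β ·)) t Y ≤ winL1 c t Y + 2πB ∑_{j < t} winL1 c j Y`.
[cite: MatomakiRadziwillTao2015, §4] -/
theorem winL1_twist_le (c : ℕ → ℂ) {β B : ℝ} (hβ : |β| ≤ B) (t Y : ℕ) :
    winL1 (fun m => c m * (𝐞 (β * m) : ℂ)) t Y ≤
      winL1 c t Y + 2 * π * B * ∑ j ∈ range t, winL1 c j Y := by
  unfold winL1
  have hB : 0 ≤ B := (abs_nonneg β).trans hβ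
  have hy : ∀ y, ‖∑ m ∈ Ioc y (y + t), c m * (𝐞 (β * m) : ℂ)‖ ≤
      ‖∑ m ∈ Ioc y (y + t), c m‖ + 2 * π * B * ∑ j ∈ range t, ‖∑ m ∈ Ioc y (y + j), c m‖ := by
    intro y
    rw [sum_Ioc_twist_eq]
    refine (norm_sub_le _ _).trans (add_le_add ?_ ?_)
    · rw [norm_mul, norm_fourierChar, mul_one]
    · refine (norm_sum_le _ _).trans ?_
      rw [Finset.mul_sum]
      refine Finset.sum_le_sum fun j _ => ?_
      rw [norm_mul]
      have h1 : ‖(𝐞 (β * ((y + j + 1 : ℕ) : ℝ)) : ℂ) - 𝐞 (β * ((y + j : ℕ) : ℝ))‖ ≤ 2 * π * B := by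
        have e : β * ((y + j + 1 : ℕ) : ℝ) = β * ((y + j : ℕ) : ℝ) + β := by push_cast; ring
        rw [e]
        exact (norm_fourierChar_add_sub_le _ _).trans (by gcongr)
      calc ‖∑ m ∈ Ioc y (y + j), c m‖ * ‖(𝐞 (β * ((y + j + 1 : ℕ) : ℝ)) : ℂ) - 𝐞 (β * ((y + j : ℕ) : ℝ))‖
          ≤ ‖∑ m ∈ Ioc y (y + j), c m‖ * (2 * π * B) :=
            mul_le_mul_of_nonneg_left h1 (norm_nonneg _)
        _ = 2 * π * B * ‖∑ m ∈ Ioc y (y + j), c m‖ := by ring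
  calc ∑ y ∈ range (Y + 1), ‖∑ m ∈ Ioc y (y + t), c m * (𝐞 (β * m) : ℂ)‖
      ≤ ∑ y ∈ range (Y + 1), (‖∑ m ∈ Ioc y (y + t), c m‖ +
          2 * π * B * ∑ j ∈ range t, ‖∑ m ∈ Ioc y (y + j), c m‖) := Finset.sum_le_sum fun y _ => hy y
    _ = _ := by
        rw [Finset.sum_add_distrib, ← Finset.mul_sum, Finset.sum_comm]

/-! ### Residue classes -/

/-- `e(a m / q) = e(a b / q)` when `m ≡ b (mod q)`. [folklore] -/
theorem fourierChar_frac_eq_of_mod_eq {a : ℤ} {q : ℕ} (hq : 0 < q) {m b : ℕ} (h : m % q = b % q) :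
    (𝐞 ((a : ℝ) * m / q) : ℂ) = 𝐞 ((a : ℝ) * b / q) := by
  have hq0 : (q : ℝ) ≠ 0 := by exact_mod_cast hq.ne'
  -- `m = b + q k` or `b = m + q k` in `ℤ`
  have hdvd : (q : ℤ) ∣ (m : ℤ) - b := (Nat.modEq_iff_dvd.mp h.symm)
  obtain ⟨k, hk⟩ := hdvd
  have e : (a : ℝ) * m / q = (a : ℝ) * b / q + ((a * k : ℤ) : ℝ) := by
    have hk' : ((m : ℤ) : ℝ) - b = q * k := by exact_mod_cast hk
    push_cast at hk' ⊢
    field_simp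
    linear_combination (a : ℝ) * hk'
  rw [e, ← fourierChar_mul_fourierChar]
  have : (𝐞 (((a * k : ℤ) : ℝ)) : ℂ) = 1 := by
    rw [Real.fourierChar_apply]
    have : ((2 * π * ((a * k : ℤ) : ℝ) : ℝ) : ℂ) * Complex.I = ((a * k : ℤ) : ℂ) * (2 * π * Complex.I) := by
      push_cast; ring
    rw [this, Complex.exp_int_mul_two_pi_mul_I]
  rw [this, mul_one]

/-- **Splitting into residue classes** ([MRT2015, §4]): for `q ≥ 1`,
`winL1 (c · e(a ·/q)) t Y ≤ ∑_{b < q} winL1 (1_{m ≡ b (q)} c) t Y`.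
[cite: MatomakiRadziwillTao2015, §4] -/
theorem winL1_residue_le (c : ℕ → ℂ) (a : ℤ) {q : ℕ} (hq : 0 < q) (t Y : ℕ) :
    winL1 (fun m => c m * (𝐞 ((a : ℝ) * m / q) : ℂ)) t Y ≤
      ∑ b ∈ range q, winL1 (fun m => if m % q = b then c m else 0) t Y := by
  unfold winL1
  rw [Finset.sum_comm]
  refine Finset.sum_le_sum fun y _ => ?_
  have hsplit : ∑ m ∈ Ioc y (y + t), c m * (𝐞 ((a : ℝ) * m / q) : ℂ) =
      ∑ b ∈ range q, (𝐞 ((a : ℝ) * b / q) : ℂ) * ∑ m ∈ Ioc y (y + t), (if m % q = b then c m else 0) := by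
    have hmaps : ∀ m ∈ Ioc y (y + t), m % q ∈ range q := fun m _ =>
      Finset.mem_range.mpr (Nat.mod_lt _ hq)
    rw [← Finset.sum_fiberwise_of_maps_to hmaps]
    refine Finset.sum_congr rfl fun b hb => ?_
    rw [Finset.sum_filter, Finset.mul_sum]
    refine Finset.sum_congr rfl fun m _ => ?_
    split_ifs with h
    · rw [fourierChar_frac_eq_of_mod_eq hq
        (h.trans (Nat.mod_eq_of_lt (Finset.mem_range.mp hb)).symm)]
      ring
    · simp
  rw [hsplit]
  refine (norm_sum_le _ _).trans (Finset.sum_le_sum fun b _ => ?_)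
  rw [norm_mul, norm_fourierChar, one_mul]

/-- **From the class `b (mod q)` to `m = d₀ m'`, `m' ≡ b₀ (mod q₀)`** with `d₀ = (b, q)`,
`q = d₀ q₀`, `b = d₀ b₀` ([MRT2015, §4]):
`∑_{y < m ≤ y+s, m ≡ b (q)} c(m) = ∑_{y/d₀ < m' ≤ (y+s)/d₀, m' ≡ b₀ (q₀)} c(d₀ m')`.
[cite: MatomakiRadziwillTao2015, §4] -/
theorem sum_filter_mod_eq_sum_div (c : ℕ → ℂ) {q b : ℕ} (hq : 0 < q) (hb : b < q) (y s : ℕ) :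
    ∑ m ∈ (Ioc y (y + s)).filter (fun m => m % q = b), c m =
      ∑ m' ∈ (Ioc (y / Nat.gcd b q) ((y + s) / Nat.gcd b q)).filter
        (fun m' => m' % (q / Nat.gcd b q) = b / Nat.gcd b q), c (Nat.gcd b q * m') := by
  set d₀ := Nat.gcd b q with hd₀
  have hd₀pos : 0 < d₀ := Nat.gcd_pos_of_pos_right _ hq
  have hd₀q : d₀ ∣ q := Nat.gcd_dvd_right b q
  have hd₀b : d₀ ∣ b := Nat.gcd_dvd_left b q
  obtain ⟨q₀, hq₀⟩ := hd₀q
  obtain ⟨b₀, hb₀⟩ := hd₀b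
  have hq₀pos : 0 < q₀ := Nat.pos_of_mul_pos_left (hq₀ ▸ hq)
  have hqd : q / d₀ = q₀ := by rw [hq₀, Nat.mul_div_cancel_left _ hd₀pos]
  have hbd : b / d₀ = b₀ := by rw [hb₀, Nat.mul_div_cancel_left _ hd₀pos]
  have hb₀q₀ : b₀ < q₀ := by
    rw [hq₀, hb₀] at hb; exact Nat.lt_of_mul_lt_mul_left hb
  rw [hqd, hbd]
  -- the index sets correspond under `m' ↦ d₀ m'`
  symm
  refine Finset.sum_nbij (fun m' => d₀ * m') (fun m' hm' => ?_) (fun m₁ _ m₂ _ h => ?_)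
    (fun m hm => ?_) (fun _ _ => rfl)
  · rw [Finset.mem_filter, Finset.mem_Ioc] at hm' ⊢
    obtain ⟨⟨h1, h2⟩, h3⟩ := hm'
    refine ⟨⟨?_, ?_⟩, ?_⟩
    · rw [Nat.div_lt_iff_lt_mul hd₀pos] at h1; linarith [mul_comm m' d₀]
    · rw [Nat.le_div_iff_mul_le hd₀pos] at h2; linarith [mul_comm m' d₀]
    · -- `d₀ m' mod (d₀ q₀) = d₀ (m' mod q₀) = d₀ b₀ = b`
      rw [hq₀, Nat.mul_mod_mul_left, h3, hb₀]
  · exact Nat.eq_of_mul_eq_mul_left hd₀pos h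
  · rw [Finset.mem_coe, Finset.mem_filter, Finset.mem_Ioc] at hm
    obtain ⟨⟨h1, h2⟩, h3⟩ := hm
    have hdm : d₀ ∣ m := by
      have : m = q * (m / q) + b := by rw [← h3]; exact (Nat.div_add_mod m q).symm
      rw [this, hq₀, hb₀, mul_assoc, ← mul_add]
      exact Dvd.intro _ rfl
    obtain ⟨m', rfl⟩ := hdm
    refine ⟨m', ?_, rfl⟩
    rw [Finset.mem_coe, Finset.mem_filter, Finset.mem_Ioc]
    refine ⟨⟨?_, ?_⟩, ?_⟩
    · rw [Nat.div_lt_iff_lt_mul hd₀pos]; linarith [mul_comm m' d₀]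
    · rw [Nat.le_div_iff_mul_le hd₀pos]; linarith [mul_comm m' d₀]
    · rw [hq₀, Nat.mul_mod_mul_left, hb₀] at h3
      exact Nat.eq_of_mul_eq_mul_left hd₀pos h3

/-- **Expansion in Dirichlet characters** of a primitive residue class: for `q₀ ≥ 1` and `b₀`
coprime to `q₀`, `|∑_{m ∈ I, m ≡ b₀ (q₀)} F(m)| ≤ (1/φ(q₀)) ∑_χ |∑_{m ∈ I} χ(m) F(m)|`.
[cite: MatomakiRadziwillTao2015, §4 ("by Fourier inversion")] -/
theorem norm_sum_filter_mod_le_sum_chars {q₀ b₀ : ℕ} (hq₀ : 0 < q₀) (hcop : Nat.Coprime b₀ q₀)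
    (I : Finset ℕ) (F : ℕ → ℂ) :
    ‖∑ m ∈ I.filter (fun m => m % q₀ = b₀ % q₀), F m‖ ≤
      (1 / (q₀.totient : ℝ)) * ∑ χ : DirichletCharacter ℂ q₀, ‖∑ m ∈ I, χ m * F m‖ := by
  haveI : NeZero q₀ := ⟨hq₀.ne'⟩
  have hunit : IsUnit ((b₀ : ℕ) : ZMod q₀) := (ZMod.isUnit_iff_coprime b₀ q₀).mpr hcop
  have htot : (0 : ℝ) < q₀.totient := by exact_mod_cast Nat.totient_pos.mpr hq₀
  -- orthogonality: `1[m ≡ b₀] = (1/φ) ∑_χ χ(b₀)⁻¹ χ(m)`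
  have horth : ∀ m : ℕ, (if m % q₀ = b₀ % q₀ then (1 : ℂ) else 0) =
      (1 / (q₀.totient : ℂ)) * ∑ χ : DirichletCharacter ℂ q₀, χ ((b₀ : ZMod q₀))⁻¹ * χ (m : ZMod q₀) := by
    intro m
    rw [DirichletCharacter.sum_char_inv_mul_char_eq ℂ hunit]
    have hiff : m % q₀ = b₀ % q₀ ↔ ((b₀ : ℕ) : ZMod q₀) = (m : ZMod q₀) := by
      rw [eq_comm, ZMod.natCast_eq_natCast_iff', eq_comm]
    by_cases h : m % q₀ = b₀ % q₀
    · rw [if_pos h, if_pos (hiff.mp h)]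
      have : (q₀.totient : ℂ) ≠ 0 := by exact_mod_cast (Nat.totient_pos.mpr hq₀).ne'
      field_simp
    · rw [if_neg h, if_neg (fun h' => h (hiff.mpr h')), mul_zero]
  have hrw : ∑ m ∈ I.filter (fun m => m % q₀ = b₀ % q₀), F m =
      (1 / (q₀.totient : ℂ)) * ∑ χ : DirichletCharacter ℂ q₀,
        χ ((b₀ : ZMod q₀))⁻¹ * ∑ m ∈ I, χ (m : ZMod q₀) * F m := by
    rw [Finset.sum_filter]
    have e1 : ∀ m ∈ I, (if m % q₀ = b₀ % q₀ then F m else 0) =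
        (if m % q₀ = b₀ % q₀ then (1 : ℂ) else 0) * F m := by
      intro m _; split_ifs <;> simp
    rw [Finset.sum_congr rfl e1]
    simp_rw [horth, Finset.mul_sum, Finset.sum_mul]
    rw [Finset.sum_comm]
    refine Finset.sum_congr rfl fun χ _ => Finset.sum_congr rfl fun m _ => by ring
  rw [hrw, norm_mul, norm_div, norm_one, Complex.norm_natCast]
  refine mul_le_mul_of_nonneg_left ((norm_sum_le _ _).trans (Finset.sum_le_sum fun χ _ => ?_))
    (by positivity)
  rw [norm_mul]
  calc ‖χ ((b₀ : ZMod q₀))⁻¹‖ * ‖∑ m ∈ I, χ (m : ZMod q₀) * F m‖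
      ≤ 1 * ‖∑ m ∈ I, χ (m : ZMod q₀) * F m‖ :=
        mul_le_mul_of_nonneg_right (χ.norm_le_one _) (norm_nonneg _)
    _ = _ := one_mul _

/-! ### Tools for the dyadic decomposition -/

/-- `x ↦ x e^{-x}` is non-increasing on `[1, ∞)`. [folklore] -/
theorem mul_exp_neg_le {a b : ℝ} (ha : 1 ≤ a) (hab : a ≤ b) :
    b * Real.exp (-b) ≤ a * Real.exp (-a) := by
  have ha0 : 0 < a := by linarith
  -- `b/a ≤ exp((b-a)/a) ≤ exp(b-a)`
  have h1 : b / a ≤ Real.exp (b - a) := by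
    calc b / a = (b - a) / a + 1 := by field_simp; ring
      _ ≤ Real.exp ((b - a) / a) := Real.add_one_le_exp _
      _ ≤ Real.exp (b - a) := by
          refine Real.exp_le_exp.mpr ?_
          rw [div_le_iff₀ ha0]; nlinarith
  have h2 : b ≤ a * Real.exp (b - a) := by rwa [div_le_iff₀' ha0] at h1
  calc b * Real.exp (-b) ≤ a * Real.exp (b - a) * Real.exp (-b) :=
        mul_le_mul_of_nonneg_right h2 (Real.exp_pos _).le
    _ = a * Real.exp (-a) := by rw [mul_assoc, ← Real.exp_add]; ring_nf

/-- Telescoping a sum over `[0, N 0]` into a low part `[0, N I]` and blocks `(N i, N (i-1)]`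
for a non-increasing `N`. [folklore] -/
theorem sum_range_eq_low_add_blocks (G : ℕ → ℝ) (N : ℕ → ℕ) (hN : ∀ i, N (i + 1) ≤ N i) (I : ℕ) :
    ∑ y ∈ range (N 0 + 1), G y =
      ∑ y ∈ range (N I + 1), G y + ∑ i ∈ Icc 1 I, ∑ y ∈ Ioc (N i) (N (i - 1)), G y := by
  induction I with
  | zero => simp
  | succ I ih =>
    rw [ih, Finset.sum_Icc_succ_top (by omega), Nat.add_sub_cancel]
    have h : ∑ y ∈ range (N I + 1), G y =
        ∑ y ∈ range (N (I + 1) + 1), G y + ∑ y ∈ Ioc (N (I + 1)) (N I), G y := by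
      rw [← Finset.sum_range_add_sum_Ico G (show N (I + 1) + 1 ≤ N I + 1 by linarith [hN I])]
      congr 1
      refine Finset.sum_congr ?_ fun _ _ => rfl
      ext k; simp only [Finset.mem_Ico, Finset.mem_Ioc]; omega
    rw [h]
    ring

/-- `‖∑_{k ≤ n < k+L, n ∈ 𝒮} f(n)‖ ≤ L` for `1`-bounded `f`. [folklore] -/
theorem norm_windowSumA2_le {f : ℕ → ℂ} (hf : ∀ n, ‖f n‖ ≤ 1) {η X₀ : ℝ}
    (I : SieveIntervalSystem η X₀) (X : ℝ) (L k : ℕ) : ‖windowSumA2 f I X L k‖ ≤ L := by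
  unfold windowSumA2
  refine (norm_sum_le _ _).trans ?_
  calc ∑ n ∈ (Ico k (k + L)).filter _, ‖f n‖ ≤ ∑ n ∈ (Ico k (k + L)).filter _, (1 : ℝ) :=
        Finset.sum_le_sum fun n _ => hf n
    _ = #((Ico k (k + L)).filter fun n : ℕ => X ≤ n ∧ (n : ℝ) ≤ 2 * X ∧ I.Mem n) := by
        simp
    _ ≤ #(Ico k (k + L)) := by exact_mod_cast Finset.card_filter_le _ _
    _ = L := by simp

/-- Cauchy–Schwarz for a sum of norms: `∑_{k ∈ s} ‖w k‖ ≤ √#s · √(∑ ‖w k‖²)`. [folklore] -/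
theorem sum_norm_le_sqrt_card_mul_sqrt {ι : Type*} (s : Finset ι) (w : ι → ℂ) :
    ∑ k ∈ s, ‖w k‖ ≤ Real.sqrt #s * Real.sqrt (∑ k ∈ s, ‖w k‖ ^ 2) := by
  have h := Real.sum_mul_le_sqrt_mul_sqrt s (fun _ => (1 : ℝ)) (fun k => ‖w k‖)
  simp only [one_mul, one_pow, Finset.sum_const, nsmul_eq_mul, mul_one] at h
  exact h

/-- The restricted window sum at `y'`: `∑_{y' < n ≤ y'+s, n ∈ 𝒮'} f(n)` with
`𝒮' = 𝒮_{P₁,Q₁,X₀,Y}`. [cite: MatomakiRadziwillTao2015, §4] -/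
def typWin (f : ℕ → ℂ) (P₁ Q₁ X₀ Y : ℝ) (s y : ℕ) : ℂ :=
  ∑ n ∈ (Ioc y (y + s)).filter (fun n => n ∈ typicalSet P₁ Q₁ X₀ Y), f n

/-- `‖typWin‖ ≤ s` for `1`-bounded `f`. [folklore] -/
theorem norm_typWin_le {f : ℕ → ℂ} (hf : ∀ n, ‖f n‖ ≤ 1) (P₁ Q₁ X₀ Y : ℝ) (s y : ℕ) :
    ‖typWin f P₁ Q₁ X₀ Y s y‖ ≤ s := by
  unfold typWin
  refine (norm_sum_le _ _).trans ?_
  calc ∑ n ∈ (Ioc y (y + s)).filter _, ‖f n‖ ≤ ∑ n ∈ (Ioc y (y + s)).filter _, (1 : ℝ) :=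
        Finset.sum_le_sum fun n _ => hf n
    _ = #((Ioc y (y + s)).filter fun n => n ∈ typicalSet P₁ Q₁ X₀ Y) := by simp
    _ ≤ #(Ioc y (y + s)) := by exact_mod_cast Finset.card_filter_le _ _
    _ = s := by simp

/-- **One dyadic block, main part**: for `y'` in `(⌊Xb⌋, ⌊2Xb⌋]` with `y' + s ≤ ⌊2Xb⌋`, the
restricted window sum equals the window sum of Theorem A.2 at height `Xb`
(`2Xb ≤ Y`, `Xb ≥ 0`). [cite: MatomakiRadziwillTao2015, §4] -/
theorem typWin_eq_windowSumA2 (f : ℕ → ℂ) {η P₁ Q₁ X₀ Y Xb : ℝ} (I : SieveIntervalSystem η X₀)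
    (hη : 0 < η) (hη8 : η ≤ 8) (hIP : I.P = seqP P₁ Q₁) (hIQ : I.Q = seqQ Q₁)
    (hXb : 0 ≤ Xb) (hY : 2 * Xb ≤ Y)
    {s y : ℕ} (hy : ⌊Xb⌋₊ < y) (hys : y + s ≤ ⌊2 * Xb⌋₊) :
    typWin f P₁ Q₁ X₀ Y s y = windowSumA2 f I Xb s (y + 1) := by
  unfold typWin windowSumA2
  have hI : Ioc y (y + s) = Ico (y + 1) (y + 1 + s) := by
    ext n; simp only [Finset.mem_Ioc, Finset.mem_Ico]; omega
  rw [hI]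
  refine Finset.sum_congr (Finset.filter_congr fun n hn => ?_) fun _ _ => rfl
  rw [Finset.mem_Ico] at hn
  have hn1 : 1 ≤ n := by omega
  rw [mem_typicalSet, mem_iff_isTypical I hη hη8 hIP hIQ (by omega : n ≠ 0)]
  have hnXb : Xb ≤ n := by
    have : (⌊Xb⌋₊ : ℝ) + 1 ≤ n := by exact_mod_cast (show ⌊Xb⌋₊ + 1 ≤ n by omega)
    linarith [Nat.lt_floor_add_one Xb]
  have hn2 : (n : ℝ) ≤ 2 * Xb := by
    have : n ≤ ⌊2 * Xb⌋₊ := by omega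
    exact le_trans (by exact_mod_cast this) (Nat.floor_le (by linarith))
  have hnY : n ≤ ⌊Y⌋₊ := Nat.le_floor (hn2.trans hY)
  constructor
  · rintro ⟨⟨-, -⟩, h⟩; exact ⟨hnXb, hn2, h⟩
  · rintro ⟨-, -, h⟩; exact ⟨⟨hn1, hnY⟩, h⟩

/-- **One dyadic block** ([MRT2015, §4], last two displays): if the discrete mean square of
Theorem A.2 at height `Xb` is `≤ Bk`, then
`∑_{⌊Xb⌋ < y' ≤ ⌊2Xb⌋} ‖typWin y'‖ ≤ √(2Xb) √Bk + s + s²` (Cauchy–Schwarz on the windows inside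
`(Xb, 2Xb]`, trivial bounds for the `≤ s` windows reaching beyond `2Xb` and one boundary window).
[cite: MatomakiRadziwillTao2015, §4] -/
theorem block_le {f : ℕ → ℂ} (hf : ∀ n, ‖f n‖ ≤ 1) {η P₁ Q₁ X₀ Y Xb Bk : ℝ}
    (I : SieveIntervalSystem η X₀) (hη : 0 < η) (hη8 : η ≤ 8) (hIP : I.P = seqP P₁ Q₁)
    (hIQ : I.Q = seqQ Q₁) (hXb : 1 ≤ Xb) (hY : 2 * Xb ≤ Y) (s : ℕ)
    (hA2 : ∑ k ∈ Icc (⌈Xb⌉₊ + 1) ⌊2 * Xb⌋₊, ‖windowSumA2 f I Xb s k‖ ^ 2 ≤ Bk) :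
    ∑ y ∈ Ioc ⌊Xb⌋₊ ⌊2 * Xb⌋₊, ‖typWin f P₁ Q₁ X₀ Y s y‖ ≤
      Real.sqrt (2 * Xb) * Real.sqrt Bk + s + (s : ℝ) ^ 2 := by
  set A := ⌊Xb⌋₊ with hA
  set B := ⌊2 * Xb⌋₊ with hB
  have hAB : A ≤ B := Nat.floor_le_floor (by linarith)
  -- split `y ≤ B - s` (main) and `y > B - s` (tail)
  rw [← Finset.sum_filter_add_sum_filter_not _ (fun y => y + s ≤ B)]
  refine add_le_add ?_ ?_
  · -- main part: equals window sums of A.2, indices `k = y + 1 ∈ [A + 2, B - s + 1]`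
    have hmain : ∑ y ∈ (Ioc A B).filter (fun y => y + s ≤ B), ‖typWin f P₁ Q₁ X₀ Y s y‖ ≤
        ∑ k ∈ Icc (⌈Xb⌉₊ + 1) B, ‖windowSumA2 f I Xb s k‖ +
          ‖windowSumA2 f I Xb s (B + 1)‖ := by
      have e1 : ∀ y ∈ (Ioc A B).filter (fun y => y + s ≤ B), ‖typWin f P₁ Q₁ X₀ Y s y‖ =
          ‖windowSumA2 f I Xb s (y + 1)‖ := by
        intro y hy
        rw [Finset.mem_filter, Finset.mem_Ioc] at hy
        rw [typWin_eq_windowSumA2 f I hη hη8 hIP hIQ (by linarith) hY hy.1.1 hy.2]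
      rw [Finset.sum_congr rfl e1]
      -- reindex `k = y + 1`
      have hceil : ⌈Xb⌉₊ ≤ A + 1 := by
        rw [hA]; exact Nat.ceil_le_floor_add_one Xb
      calc ∑ y ∈ (Ioc A B).filter (fun y => y + s ≤ B),
            ‖windowSumA2 f I Xb s (y + 1)‖
          ≤ ∑ y ∈ Ioc A B, ‖windowSumA2 f I Xb s (y + 1)‖ :=
            Finset.sum_le_sum_of_subset_of_nonneg (Finset.filter_subset _ _) fun _ _ _ => norm_nonneg _
        _ = ∑ k ∈ Ioc (A + 1) (B + 1), ‖windowSumA2 f I Xb s k‖ := by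
            rw [← Finset.map_add_right_Ioc (c := 1), Finset.sum_map]
            rfl
        _ ≤ ∑ k ∈ Icc (⌈Xb⌉₊ + 1) B ∪ {B + 1}, ‖windowSumA2 f I Xb s k‖ := by
            refine Finset.sum_le_sum_of_subset_of_nonneg (fun k hk => ?_) fun _ _ _ => norm_nonneg _
            rw [Finset.mem_Ioc] at hk
            rw [Finset.mem_union, Finset.mem_Icc, Finset.mem_singleton]
            omega
        _ ≤ _ := by
            refine (sum_union_le_add _ _ fun _ _ => norm_nonneg _).trans ?_
            rw [Finset.sum_singleton]
    refine hmain.trans ?_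
    have hcs := sum_norm_le_sqrt_card_mul_sqrt (Icc (⌈Xb⌉₊ + 1) B)
      (fun k => windowSumA2 f I Xb s k)
    have hcard : (#(Icc (⌈Xb⌉₊ + 1) B) : ℝ) ≤ 2 * Xb := by
      calc (#(Icc (⌈Xb⌉₊ + 1) B) : ℝ) = ((B + 1 - (⌈Xb⌉₊ + 1) : ℕ) : ℝ) := by rw [Nat.card_Icc]
        _ ≤ B := by exact_mod_cast (by omega : B + 1 - (⌈Xb⌉₊ + 1) ≤ B)
        _ ≤ 2 * Xb := Nat.floor_le (by linarith)
    have h1 : Real.sqrt #(Icc (⌈Xb⌉₊ + 1) B) ≤ Real.sqrt (2 * Xb) := Real.sqrt_le_sqrt hcard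
    have h2 : Real.sqrt (∑ k ∈ Icc (⌈Xb⌉₊ + 1) B,
        ‖windowSumA2 f I Xb s k‖ ^ 2) ≤ Real.sqrt Bk := Real.sqrt_le_sqrt hA2
    have h3 := norm_windowSumA2_le hf I Xb s (B + 1)
    calc _ ≤ Real.sqrt #(Icc (⌈Xb⌉₊ + 1) B) * Real.sqrt (∑ k ∈ Icc (⌈Xb⌉₊ + 1) B,
          ‖windowSumA2 f I Xb s k‖ ^ 2) + s := add_le_add hcs h3
      _ ≤ Real.sqrt (2 * Xb) * Real.sqrt Bk + s := by
          gcongr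
  · -- tail part: at most `s` values of `y`, each window of norm `≤ s`
    calc ∑ y ∈ (Ioc A B).filter (fun y => ¬ y + s ≤ B), ‖typWin f P₁ Q₁ X₀ Y s y‖
        ≤ ∑ y ∈ (Ioc A B).filter (fun y => ¬ y + s ≤ B), (s : ℝ) :=
          Finset.sum_le_sum fun y _ => norm_typWin_le hf P₁ Q₁ X₀ Y s y
      _ = #((Ioc A B).filter (fun y => ¬ y + s ≤ B)) * s := by rw [Finset.sum_const, nsmul_eq_mul]
      _ ≤ s * s := by
          refine mul_le_mul_of_nonneg_right ?_ (Nat.cast_nonneg s)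
          have : #((Ioc A B).filter (fun y => ¬ y + s ≤ B)) ≤ #(Ioc (B - s) B) := by
            refine Finset.card_le_card fun y hy => ?_
            rw [Finset.mem_filter, Finset.mem_Ioc] at hy
            rw [Finset.mem_Ioc]; omega
          rw [Nat.card_Ioc] at this
          exact_mod_cast this.trans (by omega)
      _ = (s : ℝ) ^ 2 := by ring

/-! ### Elementary inequalities for the error terms -/

/-- `√(a + b) ≤ √a + √b`. [folklore] -/
theorem sqrt_add_le_sqrt_add_sqrt {a b : ℝ} (ha : 0 ≤ a) (hb : 0 ≤ b) :
    Real.sqrt (a + b) ≤ Real.sqrt a + Real.sqrt b := by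
  rw [Real.sqrt_le_left (by positivity)]
  have h1 := Real.sq_sqrt ha
  have h2 := Real.sq_sqrt hb
  nlinarith [Real.sqrt_nonneg a, Real.sqrt_nonneg b]

/-- `2 log X ≤ √X` for `log X ≥ 16` (`X > 0`). [folklore] -/
theorem two_mul_log_le_sqrt {X : ℝ} (hX0 : 0 < X) (hX : 16 ≤ Real.log X) :
    2 * Real.log X ≤ Real.sqrt X := by
  set u := Real.log X with hu
  have hexp : Real.sqrt X = Real.exp (u / 2) := by
    rw [hu, show Real.log X / 2 = Real.log X * (1 / 2) by ring, Real.exp_mul, Real.exp_log hX0,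
      Real.sqrt_eq_rpow]
  rw [hexp]
  have h1 := Real.pow_div_factorial_le_exp (u / 2) (by linarith) 2
  have h2 : (Nat.factorial 2 : ℝ) = 2 := by norm_num [Nat.factorial]
  rw [h2] at h1
  nlinarith

/-! ### The major arc estimate for one character: Theorem A.2 on dyadic blocks -/

/-- The restricted, `1`-bounded summand `1_{𝒮'}(n) f(n)`. [cite: MatomakiRadziwillTao2015, §4] -/
def typFun (f : ℕ → ℂ) (P₁ Q₁ X₀ Y : ℝ) (n : ℕ) : ℂ :=
  if n ∈ typicalSet P₁ Q₁ X₀ Y then f n else 0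

/-- `typWin` is the window sum of `typFun`. [folklore] -/
theorem sum_Ioc_typFun (f : ℕ → ℂ) (P₁ Q₁ X₀ Y : ℝ) (s y : ℕ) :
    ∑ n ∈ Ioc y (y + s), typFun f P₁ Q₁ X₀ Y n = typWin f P₁ Q₁ X₀ Y s y := by
  unfold typFun typWin
  rw [Finset.sum_filter]

/-- `‖typFun‖ ≤ 1` for `1`-bounded `f`. [folklore] -/
theorem norm_typFun_le {f : ℕ → ℂ} (hf : ∀ n, ‖f n‖ ≤ 1) (P₁ Q₁ X₀ Y : ℝ) (n : ℕ) :
    ‖typFun f P₁ Q₁ X₀ Y n‖ ≤ 1 := by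
  unfold typFun; split_ifs <;> simp [hf n]

/-- **The three error terms of Theorem A.2 in the regime of Theorem 2.3** (`η = 1/20`,
`P₁ = W^{200}`): `(1+M)e^{-M} ≤ (1+M_low)e^{-M_low}` (`M ≥ M_low ≥ 0`),
`(log s)^{1/3}/P₁^{7/60} ≤ W^{-5/2}` (`log s ≤ W^{1/5} + 2`), `(log X_b)^{-1/50} ≤ 2W^{-5/2}`
(`X_b ≥ √X`, `W^{125} ≤ log X`). [cite: MatomakiRadziwillTao2015, §4] -/
theorem errorTerms_le {W Mlow M ls Xb X : ℝ} (hW1 : 2 ≤ W) (hMlow : 1 ≤ Mlow) (hM : Mlow ≤ M)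
    (hls0 : 0 ≤ ls) (hls : ls ≤ W ^ (1 / 5 : ℝ) + 2) (hX0 : 0 < X) (hXb : Real.sqrt X ≤ Xb)
    (hW125 : W ^ 125 ≤ Real.log X) :
    (1 + M) * Real.exp (-M) + ls ^ (1 / 3 : ℝ) / (W ^ 200) ^ (1 / 6 - 1 / 20 : ℝ) +
        1 / Real.log Xb ^ (1 / 50 : ℝ) ≤
      (1 + Mlow) * Real.exp (-Mlow) + 3 / (W ^ ((5 : ℝ) / 4) * W ^ ((5 : ℝ) / 4)) := by
  have hW0 : 0 < W := by linarith
  have hW1' : 1 ≤ W := by linarith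
  have hww : W ^ ((5 : ℝ) / 4) * W ^ ((5 : ℝ) / 4) = W ^ ((5 : ℝ) / 2) := by
    rw [← Real.rpow_add hW0]; norm_num
  rw [hww]
  have hW52 : 0 < W ^ ((5 : ℝ) / 2) := Real.rpow_pos_of_pos hW0 _
  -- (α)
  have hα : (1 + M) * Real.exp (-M) ≤ (1 + Mlow) * Real.exp (-Mlow) :=
    Tao2016.one_add_mul_exp_neg_le (by linarith) hM
  -- (β)
  have hβ : ls ^ (1 / 3 : ℝ) / (W ^ 200) ^ (1 / 6 - 1 / 20 : ℝ) ≤ 1 / W ^ ((5 : ℝ) / 2) := by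
    -- `ls ≤ W^{1/5} + 2 ≤ 3 W^{1/5} ≤ W^2 · W^{1/5}` hence `ls^{1/3} ≤ W^{11/15}`
    have hW15 : 1 ≤ W ^ (1 / 5 : ℝ) := Real.one_le_rpow hW1' (by norm_num)
    have hls' : ls ≤ W ^ ((11 : ℝ) / 5) := by
      calc ls ≤ W ^ (1 / 5 : ℝ) + 2 := hls
        _ ≤ 3 * W ^ (1 / 5 : ℝ) := by linarith
        _ ≤ W ^ (2 : ℝ) * W ^ (1 / 5 : ℝ) := by
            refine mul_le_mul_of_nonneg_right ?_ (by positivity)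
            rw [show W ^ (2 : ℝ) = W ^ 2 by norm_num]; nlinarith
        _ = W ^ ((11 : ℝ) / 5) := by rw [← Real.rpow_add hW0]; norm_num
    have h1 : ls ^ (1 / 3 : ℝ) ≤ W ^ ((11 : ℝ) / 15) := by
      calc ls ^ (1 / 3 : ℝ) ≤ (W ^ ((11 : ℝ) / 5)) ^ (1 / 3 : ℝ) := Real.rpow_le_rpow hls0 hls' (by norm_num)
        _ = W ^ ((11 : ℝ) / 15) := by rw [← Real.rpow_mul hW0.le]; norm_num
    have h2 : (W ^ 200 : ℝ) ^ (1 / 6 - 1 / 20 : ℝ) = W ^ ((70 : ℝ) / 3) := by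
      rw [show (W ^ 200 : ℝ) = W ^ (200 : ℝ) by norm_num, ← Real.rpow_mul hW0.le]
      norm_num
    rw [h2, div_le_div_iff₀ (Real.rpow_pos_of_pos hW0 _) hW52, one_mul]
    calc ls ^ (1 / 3 : ℝ) * W ^ ((5 : ℝ) / 2) ≤ W ^ ((11 : ℝ) / 15) * W ^ ((5 : ℝ) / 2) :=
          mul_le_mul_of_nonneg_right h1 hW52.le
      _ = W ^ ((11 : ℝ) / 15 + 5 / 2) := (Real.rpow_add hW0 _ _).symm
      _ ≤ W ^ ((70 : ℝ) / 3) := Real.rpow_le_rpow_of_exponent_le hW1' (by norm_num)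
  -- (γ)
  have hγ : 1 / Real.log Xb ^ (1 / 50 : ℝ) ≤ 2 / W ^ ((5 : ℝ) / 2) := by
    have hXb0 : 0 < Xb := lt_of_lt_of_le (Real.sqrt_pos.mpr hX0) hXb
    have hlogXb : W ^ 125 / 2 ≤ Real.log Xb := by
      have h1 : Real.log (Real.sqrt X) ≤ Real.log Xb := Real.log_le_log (Real.sqrt_pos.mpr hX0) hXb
      rw [Real.log_sqrt hX0.le] at h1
      linarith
    have hlogXb0 : 0 < Real.log Xb := lt_of_lt_of_le (by positivity) hlogXb
    have h2 : (W ^ 125 / 2 : ℝ) ^ (1 / 50 : ℝ) ≤ Real.log Xb ^ (1 / 50 : ℝ) :=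
      Real.rpow_le_rpow (by positivity) hlogXb (by norm_num)
    have h3 : (W ^ 125 / 2 : ℝ) ^ (1 / 50 : ℝ) = W ^ ((5 : ℝ) / 2) / 2 ^ (1 / 50 : ℝ) := by
      rw [Real.div_rpow (by positivity) (by norm_num), show (W ^ 125 : ℝ) = W ^ (125 : ℝ) by norm_num,
        ← Real.rpow_mul hW0.le]
      norm_num
    have h4 : (2 : ℝ) ^ (1 / 50 : ℝ) ≤ 2 := by
      calc (2 : ℝ) ^ (1 / 50 : ℝ) ≤ 2 ^ (1 : ℝ) := Real.rpow_le_rpow_of_exponent_le (by norm_num) (by norm_num)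
        _ = 2 := Real.rpow_one 2
    have h5 : W ^ ((5 : ℝ) / 2) / 2 ≤ Real.log Xb ^ (1 / 50 : ℝ) := by
      calc W ^ ((5 : ℝ) / 2) / 2 ≤ W ^ ((5 : ℝ) / 2) / 2 ^ (1 / 50 : ℝ) :=
            div_le_div_of_nonneg_left hW52.le (by positivity) h4
        _ = (W ^ 125 / 2 : ℝ) ^ (1 / 50 : ℝ) := h3.symm
        _ ≤ _ := h2
    rw [div_le_div_iff₀ (Real.rpow_pos_of_pos hlogXb0 _) hW52]
    linarith
  have e : (3 : ℝ) / W ^ ((5 : ℝ) / 2) = 1 / W ^ ((5 : ℝ) / 2) + 2 / W ^ ((5 : ℝ) / 2) := by ring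
  linarith

/-- Geometric sum of the dyadic heights: `∑_{1 ≤ i ≤ I} Y/2^i ≤ Y` (`Y ≥ 0`). [folklore] -/
theorem sum_div_two_pow_le {Y : ℝ} (hY : 0 ≤ Y) (I : ℕ) : ∑ i ∈ Icc 1 I, Y / 2 ^ i ≤ Y := by
  have h1 : ∑ i ∈ Icc 1 I, Y / 2 ^ i = Y * ((1 / 2) * ∑ k ∈ range I, (1 / 2 : ℝ) ^ k) := by
    rw [Finset.mul_sum, Finset.mul_sum, ← Finset.Ico_add_one_right_eq_Icc, Finset.sum_Ico_eq_sum_range,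
      Nat.add_sub_cancel]
    refine Finset.sum_congr rfl fun k _ => ?_
    rw [pow_add, pow_one, one_div_pow]
    field_simp
  rw [h1]
  have h2 : ∑ k ∈ range I, (1 / 2 : ℝ) ^ k ≤ 2 := sum_geometric_two_le I
  calc Y * (1 / 2 * ∑ k ∈ range I, (1 / 2 : ℝ) ^ k) ≤ Y * (1 / 2 * 2) := by gcongr
    _ = Y := by ring

/-- **Final numerics** of `winL1_typical_le`: with `B = E + 3/w²`,
`2√(C_A B) s Y₁ + I (s + s²) + (Y₁/W^{10} + 1) s ≤ (4√C_A + 4) s Y₁ (√E + 1/w)` in the regime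
`I ≤ 2W^{10}`, `w ≤ W²`, `w ≤ Y₁`, `4 W^{12} s ≤ Y₁`. [cite: MatomakiRadziwillTao2015, §4] -/
theorem final_numerics {C_A E s Y₁ W w I : ℝ} (hC : 0 ≤ C_A) (hE : 0 ≤ E) (hw0 : 0 < w)
    (hW1 : 1 ≤ W) (hwW2 : w ≤ W ^ 2) (hs1 : 1 ≤ s) (hY₁0 : 0 < Y₁)
    (hIle : I ≤ 2 * W ^ 10) (hY₁w : w ≤ Y₁) (hsY : 4 * W ^ 12 * s ≤ Y₁) :
    2 * Real.sqrt (C_A * (E + 3 / (w * w))) * s * Y₁ + I * (s + s ^ 2) + (Y₁ / W ^ 10 + 1) * s ≤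
      (4 * Real.sqrt C_A + 4) * s * Y₁ * (Real.sqrt E + 1 / w) := by
  have hW0 : 0 < W := by linarith
  have hs0 : 0 < s := by linarith
  have hsqrtB : Real.sqrt (C_A * (E + 3 / (w * w))) ≤ Real.sqrt C_A * (Real.sqrt E + 2 / w) := by
    rw [Real.sqrt_mul hC]
    refine mul_le_mul_of_nonneg_left ?_ (Real.sqrt_nonneg _)
    refine (sqrt_add_le_sqrt_add_sqrt hE (by positivity)).trans (add_le_add le_rfl ?_)
    rw [Real.sqrt_le_left (by positivity)]
    have : (2 / w) ^ 2 = 4 / (w * w) := by ring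
    rw [this]
    exact div_le_div_of_nonneg_right (by norm_num) (by positivity)
  have hIs : I * (s + s ^ 2) ≤ s * Y₁ / w := by
    have h1 : I * (s + s ^ 2) ≤ 2 * W ^ 10 * (2 * s ^ 2) := by
      have : s + s ^ 2 ≤ 2 * s ^ 2 := by nlinarith
      exact mul_le_mul hIle this (by positivity) (by positivity)
    refine h1.trans ?_
    rw [le_div_iff₀ hw0]
    have h2 : 4 * W ^ 10 * s ^ 2 * w ≤ 4 * W ^ 12 * s ^ 2 := by
      calc 4 * W ^ 10 * s ^ 2 * w ≤ 4 * W ^ 10 * s ^ 2 * W ^ 2 := by gcongr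
        _ = 4 * W ^ 12 * s ^ 2 := by ring
    calc 2 * W ^ 10 * (2 * s ^ 2) * w = 4 * W ^ 10 * s ^ 2 * w := by ring
      _ ≤ 4 * W ^ 12 * s ^ 2 := h2
      _ = (4 * W ^ 12 * s) * s := by ring
      _ ≤ Y₁ * s := mul_le_mul_of_nonneg_right hsY hs0.le
      _ = s * Y₁ := by ring
  have hlow' : (Y₁ / W ^ 10 + 1) * s ≤ 2 * (s * Y₁ / w) := by
    have h1 : Y₁ / W ^ 10 ≤ Y₁ / w := by
      refine div_le_div_of_nonneg_left hY₁0.le hw0 (hwW2.trans ?_)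
      exact pow_le_pow_right₀ hW1 (by norm_num)
    have h2 : (1 : ℝ) ≤ Y₁ / w := by rw [le_div_iff₀ hw0, one_mul]; exact hY₁w
    have h3 : (Y₁ / W ^ 10 + 1) * s ≤ (Y₁ / w + Y₁ / w) * s := by gcongr
    refine h3.trans (le_of_eq ?_)
    field_simp
    ring
  have hmain' : 2 * Real.sqrt (C_A * (E + 3 / (w * w))) * s * Y₁ ≤
      2 * Real.sqrt C_A * Real.sqrt E * s * Y₁ + 4 * Real.sqrt C_A * (s * Y₁ / w) := by
    have := mul_le_mul_of_nonneg_right hsqrtB (show 0 ≤ 2 * s * Y₁ by positivity)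
    have e : Real.sqrt C_A * (Real.sqrt E + 2 / w) * (2 * s * Y₁) =
        2 * Real.sqrt C_A * Real.sqrt E * s * Y₁ + 4 * Real.sqrt C_A * (s * Y₁ / w) := by
      field_simp
      ring
    nlinarith
  have hsY0 : 0 ≤ s * Y₁ / w := by positivity
  have hE0 : 0 ≤ Real.sqrt E := Real.sqrt_nonneg _
  have hC0 : 0 ≤ Real.sqrt C_A := Real.sqrt_nonneg _
  have e : (4 * Real.sqrt C_A + 4) * s * Y₁ * (Real.sqrt E + 1 / w) =
      4 * Real.sqrt C_A * Real.sqrt E * s * Y₁ + 4 * (Real.sqrt E * (s * Y₁)) +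
        4 * Real.sqrt C_A * (s * Y₁ / w) + 4 * (s * Y₁ / w) := by
    field_simp
    ring
  rw [e]
  have : 0 ≤ Real.sqrt E * (s * Y₁) := by positivity
  have : 0 ≤ Real.sqrt C_A * Real.sqrt E * s * Y₁ := by positivity
  nlinarith

set_option maxHeartbeats 1600000 in
/-- **The major arc estimate for a single multiplicative function** ([MRT2015, §4], from "The
summand vanishes unless `y ≤ X/d₁`" to the end of the section), discrete form: for `f`
`1`-bounded multiplicative with `M(f; X_b) ≥ M_low ≥ 1` at all heights
`X₃/(4 d₁ W^{10}) ≤ X_b ≤ X`, windows of length `s ∈ [L/W³ + 1/2, 3L]`, `d₁ < W²`, and the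
parameter regime of Theorem 2.3 with `W ≤ log^{1/125} X` (and `L W^{15} ≤ X`,
`L ≤ exp(√(log X / 2))`, `(log L)⁵ ≤ W`, `W^{203} ≤ L`),
`∑_{y ≤ X₃/d₁} |∑_{y < n ≤ y+s, n ∈ 𝒮'} f(n)| ≤ C s (X₃/d₁) (√((1+M_low)e^{-M_low}) + W^{-5/4})`,
`𝒮' = 𝒮_{W^{200}, L/W³, √X₃, X₃/d₁}`: the contribution of `y ≤ X₃/(d₁ W^{10})` is trivial, and on
each dyadic block Cauchy–Schwarz and Theorem A.2 (`theoremA2_discrete`, `η = 1/20`) apply, the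
three error terms being `≤ (1+M_low)e^{-M_low}`, `≤ W^{-5/2}`, `≤ 2 W^{-5/2}` (`errorTerms_le`).
[cite: MatomakiRadziwillTao2015, §4] -/
theorem winL1_typical_le (hA2 : MatomakiRadziwillTao2015_theoremA2) :
    ∃ C W₀ Xs : ℝ, 0 < C ∧ ∀ (X X₃ W : ℝ) (L d₁ s : ℕ) (f : ArithmeticFunction ℂ) (Mlow : ℝ),
      f.IsMultiplicative → (∀ n, ‖f n‖ ≤ 1) →
      Xs ≤ X → X ≤ X₃ → X₃ ≤ 2 * X → W₀ ≤ W → W ≤ Real.log X ^ (1 / 125 : ℝ) →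
      1 ≤ d₁ → (d₁ : ℝ) < W ^ 2 →
      W ^ 203 ≤ (L : ℝ) → (L : ℝ) * W ^ 15 ≤ X → (L : ℝ) ≤ Real.exp (Real.sqrt (Real.log X / 2)) →
      Real.log L ^ 5 ≤ W → (L : ℝ) / W ^ 3 + 1 / 2 ≤ s → (s : ℝ) ≤ 3 * L →
      1 ≤ Mlow → (∀ Xb : ℝ, X₃ / (4 * d₁ * W ^ 10) ≤ Xb → Xb ≤ X → Mlow ≤ minPretentiousDistSq f Xb Xb) →
      winL1 (typFun f (W ^ 200) (L / W ^ 3) (Real.sqrt X₃) (X₃ / d₁)) s ⌊X₃ / d₁⌋₊ ≤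
        C * s * (X₃ / d₁) * (Real.sqrt ((1 + Mlow) * Real.exp (-Mlow)) + W ^ (-(5 : ℝ) / 4)) := by
  obtain ⟨C_A, Xη, hC_A0, hdisc⟩ := theoremA2_discrete hA2 (1 / 20) (by norm_num) (by norm_num)
  obtain ⟨P₀, hP₀⟩ := def21_system (η := 1 / 20) (by norm_num) (by norm_num)
  refine ⟨4 * Real.sqrt C_A + 4, max 64 P₀, max (Real.exp 16) (4 * Xη ^ 2 + 4 * |Xη| + 4),
    by positivity, ?_⟩
  intro X X₃ W L d₁ s f Mlow hf hf1 hXs hXX₃ hX₃ hW₀ hWX hd₁ hd₁W hWL hLX hLexp hlogL hsL hsL' hMlow hM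
  -- basic facts
  have hW64 : (64 : ℝ) ≤ W := (le_max_left _ _).trans hW₀
  have hWP₀ : P₀ ≤ W := (le_max_right _ _).trans hW₀
  have hW1 : (1 : ℝ) ≤ W := by linarith
  have hW0 : (0 : ℝ) < W := by linarith
  have hX16 : 16 ≤ Real.log X := by
    have h := (le_max_left _ _).trans hXs
    have := Real.log_le_log (Real.exp_pos _) h
    rwa [Real.log_exp] at this
  have hX0 : 0 < X := lt_of_lt_of_le (Real.exp_pos 16) ((le_max_left _ _).trans hXs)
  have hX1 : 1 ≤ X := by
    have : (1 : ℝ) ≤ Real.exp 16 := Real.one_le_exp (by norm_num)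
    exact this.trans ((le_max_left _ _).trans hXs)
  have hXη : 4 * Xη ^ 2 + 4 * |Xη| + 4 ≤ X := (le_max_right _ _).trans hXs
  have hX₃0 : 0 < X₃ := by linarith
  have hd₁0 : (0 : ℝ) < d₁ := by exact_mod_cast hd₁
  have hd₁1 : (1 : ℝ) ≤ d₁ := by exact_mod_cast hd₁
  have hL0 : (0 : ℝ) < L := lt_of_lt_of_le (by positivity) hWL
  have hs0 : (0 : ℝ) < s := by
    have : (0 : ℝ) < (L : ℝ) / W ^ 3 := by positivity
    linarith
  set Y₁ : ℝ := X₃ / d₁ with hY₁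
  have hY₁X₃ : Y₁ ≤ X₃ := div_le_self hX₃0.le hd₁1
  have hY₁0 : 0 < Y₁ := by positivity
  -- `W^{12} ≤ log X ≤ √X / 2`
  have hlogX1 : 1 ≤ Real.log X := by linarith
  have hW125 : W ^ (125 : ℕ) ≤ Real.log X := by
    have h := Real.rpow_le_rpow hW0.le hWX (by norm_num : (0 : ℝ) ≤ 125)
    rw [← Real.rpow_mul (by linarith : (0 : ℝ) ≤ Real.log X),
      show (1 / 125 : ℝ) * 125 = 1 by norm_num, Real.rpow_one,
      show (125 : ℝ) = (125 : ℕ) by norm_num, Real.rpow_natCast] at h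
    exact h
  have hW12 : W ^ (12 : ℕ) ≤ Real.log X := le_trans (pow_le_pow_right₀ hW1 (by norm_num)) hW125
  have hsqrtX : 2 * Real.log X ≤ Real.sqrt X := two_mul_log_le_sqrt hX0 hX16
  have hY₁low : X / W ^ 2 ≤ Y₁ := by
    rw [hY₁, div_le_div_iff₀ (by positivity) hd₁0]
    nlinarith
  -- the dyadic parameters
  set I : ℕ := Nat.log 2 ⌊W ^ 10⌋₊ + 1 with hI
  have hWfloor : ⌊W ^ 10⌋₊ ≠ 0 := by
    have : (1 : ℝ) ≤ W ^ 10 := one_le_pow₀ hW1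
    exact Nat.pos_iff_ne_zero.mp (Nat.floor_pos.mpr this)
  have h2I_low : W ^ 10 < (2 : ℝ) ^ I := by
    have h1 : ⌊W ^ 10⌋₊ < 2 ^ I := Nat.lt_pow_succ_log_self one_lt_two _
    calc W ^ 10 < ⌊W ^ 10⌋₊ + 1 := Nat.lt_floor_add_one _
      _ ≤ (2 : ℝ) ^ I := by exact_mod_cast h1
  have h2I_up : (2 : ℝ) ^ I ≤ 2 * W ^ 10 := by
    have h1 : 2 ^ (I - 1) ≤ ⌊W ^ 10⌋₊ := by
      rw [hI, Nat.add_sub_cancel]; exact Nat.pow_log_le_self 2 hWfloor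
    have h2 : ((2 ^ (I - 1) : ℕ) : ℝ) ≤ W ^ 10 :=
      le_trans (by exact_mod_cast h1) (Nat.floor_le (by positivity))
    have e : (2 : ℝ) ^ I = 2 * 2 ^ (I - 1) := by
      rw [← pow_succ', Nat.sub_add_cancel (by rw [hI]; omega)]
    rw [e]; push_cast at h2; linarith
  have hIle : (I : ℝ) ≤ 2 * W ^ 10 := by
    have : (I : ℝ) < (2 : ℝ) ^ I := by exact_mod_cast Nat.lt_two_pow_self
    linarith
  set N : ℕ → ℕ := fun i => ⌊Y₁ / 2 ^ i⌋₊ with hN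
  have hN0 : N 0 = ⌊Y₁⌋₊ := by simp [hN]
  have hNanti : ∀ i, N (i + 1) ≤ N i := by
    intro i
    refine Nat.floor_le_floor ?_
    rw [pow_succ]
    exact div_le_div_of_nonneg_left hY₁0.le (by positivity) (by linarith [pow_pos (two_pos : (0:ℝ) < 2) i])
  -- heights of the blocks
  have hXb_range : ∀ i ∈ Icc 1 I, X₃ / (4 * d₁ * W ^ 10) ≤ Y₁ / 2 ^ i ∧ Y₁ / 2 ^ i ≤ X ∧
      Real.sqrt X ≤ Y₁ / 2 ^ i ∧ Real.sqrt X₃ ≤ Y₁ / 2 ^ i ∧ 2 * (Y₁ / 2 ^ i) ≤ Y₁ := by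
    intro i hi
    rw [Finset.mem_Icc] at hi
    have h2i : (2 : ℝ) ^ i ≤ 2 ^ I := pow_le_pow_right₀ (by norm_num) hi.2
    have h2i1 : (2 : ℝ) ≤ 2 ^ i := by
      calc (2 : ℝ) = 2 ^ 1 := by norm_num
        _ ≤ 2 ^ i := pow_le_pow_right₀ (by norm_num) hi.1
    have hlow : Y₁ / (2 * W ^ 10) ≤ Y₁ / 2 ^ i :=
      div_le_div_of_nonneg_left hY₁0.le (by positivity) (h2i.trans h2I_up)
    refine ⟨?_, ?_, ?_, ?_, ?_⟩
    · calc X₃ / (4 * d₁ * W ^ 10) ≤ X₃ / (2 * d₁ * W ^ 10) :=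
            div_le_div_of_nonneg_left hX₃0.le (by positivity) (by nlinarith [pow_pos hW0 10])
        _ = Y₁ / (2 * W ^ 10) := by rw [hY₁]; field_simp
        _ ≤ _ := hlow
    · calc Y₁ / 2 ^ i ≤ Y₁ / 2 := div_le_div_of_nonneg_left hY₁0.le (by norm_num) h2i1
        _ ≤ X₃ / 2 := by linarith
        _ ≤ X := by linarith
    · -- `√X ≤ X/(2W^{12}) ≤ Y₁/(2W^{10})`
      have h1 : Real.sqrt X * (2 * W ^ 12) ≤ X := by
        have hs := Real.sq_sqrt hX0.le
        have hs0 := Real.sqrt_nonneg X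
        calc Real.sqrt X * (2 * W ^ 12) ≤ Real.sqrt X * (2 * Real.log X) := by gcongr
          _ ≤ Real.sqrt X * Real.sqrt X := by gcongr
          _ = X := by rw [← sq, hs]
      have h2 : Real.sqrt X ≤ Y₁ / (2 * W ^ 10) := by
        rw [le_div_iff₀ (by positivity)]
        calc Real.sqrt X * (2 * W ^ 10) = Real.sqrt X * (2 * W ^ 12) / W ^ 2 := by
              field_simp
          _ ≤ X / W ^ 2 := div_le_div_of_nonneg_right h1 (by positivity)
          _ ≤ Y₁ := hY₁low
      exact h2.trans hlow
    · have h1 : Real.sqrt X₃ ≤ Real.sqrt (2 * X) := Real.sqrt_le_sqrt hX₃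
      have h2 : Real.sqrt (2 * X) ≤ 2 * Real.sqrt X := by
        rw [Real.sqrt_le_left (by positivity)]
        nlinarith [Real.sq_sqrt hX0.le, Real.sqrt_nonneg X]
      -- `2√X ≤ X/W^{12} ≤ Y₁ / 2^i` similarly
      have h3 : 2 * Real.sqrt X ≤ Y₁ / (2 * W ^ 10) := by
        rw [le_div_iff₀ (by positivity)]
        have h1' : Real.sqrt X * (4 * W ^ 12) ≤ X := by
          have hs := Real.sq_sqrt hX0.le
          have : 4 * W ^ 12 ≤ Real.sqrt X := by
            have hW4 : 4 * W ^ 12 ≤ 2 * Real.log X := by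
              have : 2 * W ^ 12 ≤ W ^ 13 := by nlinarith [pow_pos hW0 12]
              have h13 : W ^ (13 : ℕ) ≤ Real.log X := le_trans (pow_le_pow_right₀ hW1 (by norm_num)) hW125
              linarith
            linarith
          calc Real.sqrt X * (4 * W ^ 12) ≤ Real.sqrt X * Real.sqrt X := by gcongr
            _ = X := by rw [← sq, hs]
        calc 2 * Real.sqrt X * (2 * W ^ 10) = Real.sqrt X * (4 * W ^ 12) / W ^ 2 := by
              field_simp
              ring
          _ ≤ X / W ^ 2 := div_le_div_of_nonneg_right h1' (by positivity)
          _ ≤ Y₁ := hY₁low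
      linarith [hlow]
    · rw [show 2 * (Y₁ / 2 ^ i) = Y₁ * (2 / 2 ^ i) by ring]
      exact mul_le_of_le_one_right hY₁0.le ((div_le_one (by positivity)).mpr h2i1)
  -- parameters of Theorem A.2
  set P₁ : ℝ := W ^ 200 with hP₁
  set Q₁ : ℝ := (L : ℝ) / W ^ 3 with hQ₁
  have hP₁1 : 1 ≤ P₁ := one_le_pow₀ hW1
  have hWP₁ : W ≤ P₁ := by
    calc W = W ^ 1 := (pow_one W).symm
      _ ≤ W ^ 200 := pow_le_pow_right₀ hW1 (by norm_num)
  have hP₁Q₁ : P₁ ≤ Q₁ := by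
    rw [hQ₁, le_div_iff₀ (by positivity), hP₁, ← pow_add]; exact hWL
  have hQ₁1 : 1 ≤ Q₁ := hP₁1.trans hP₁Q₁
  have hlogL : Real.log L ≤ W ^ (1 / 5 : ℝ) := by
    have hlogL0 : 0 ≤ Real.log L := Real.log_nonneg (by exact_mod_cast Nat.one_le_iff_ne_zero.mpr (by
      rintro rfl; simp at hL0))
    have h := Real.rpow_le_rpow (by positivity) hlogL (by norm_num : (0 : ℝ) ≤ 1 / 5)
    rw [← Real.rpow_natCast, ← Real.rpow_mul hlogL0] at h
    norm_num at h
    exact h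
  have hQ₁exp : Q₁ ≤ Real.exp (Real.sqrt (Real.log (Real.sqrt X₃))) := by
    have h1 : Q₁ ≤ L := div_le_self (Nat.cast_nonneg L) (one_le_pow₀ hW1)
    refine h1.trans (hLexp.trans (Real.exp_le_exp.mpr (Real.sqrt_le_sqrt ?_)))
    rw [Real.log_sqrt hX₃0.le]
    linarith [Real.log_le_log hX0 hXX₃]
  have hcond := hP₀ P₁ Q₁ (Real.sqrt X₃) (hWP₀.trans hWP₁) hP₁Q₁ (by
    -- `(log Q₁)^{800} ≤ W^{160} ≤ W^{200}`
    have hlogQ₁ : Real.log Q₁ ≤ W ^ (1 / 5 : ℝ) :=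
      le_trans (Real.log_le_log (by positivity) (div_le_self (Nat.cast_nonneg L) (one_le_pow₀ hW1))) hlogL
    have hlogQ₁0 : 0 ≤ Real.log Q₁ := Real.log_nonneg hQ₁1
    calc Real.log Q₁ ^ (40 / (1 / 20 : ℝ)) ≤ (W ^ (1 / 5 : ℝ)) ^ (40 / (1 / 20 : ℝ)) :=
          Real.rpow_le_rpow hlogQ₁0 hlogQ₁ (by norm_num)
      _ = W ^ (160 : ℝ) := by rw [← Real.rpow_mul hW0.le]; norm_num
      _ ≤ W ^ (200 : ℝ) := Real.rpow_le_rpow_of_exponent_le hW1 (by norm_num)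
      _ = P₁ := by rw [hP₁, show (200 : ℝ) = (200 : ℕ) by norm_num, Real.rpow_natCast]) hQ₁exp
  obtain ⟨Isys, hIP, hIQ⟩ := hcond
  have hs4 : 4 ≤ s := by
    have : (4 : ℝ) ≤ s := by
      have : (4 : ℝ) ≤ (L : ℝ) / W ^ 3 := by
        rw [le_div_iff₀ (by positivity)]
        calc 4 * W ^ 3 ≤ W * W ^ 3 := by gcongr; linarith
          _ = W ^ 4 := by ring
          _ ≤ W ^ 203 := pow_le_pow_right₀ hW1 (by norm_num)
          _ ≤ L := hWL
      linarith
    exact_mod_cast this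
  have hXηlt : Xη < Real.sqrt X := by
    have h1 : (2 * |Xη| + 1) ^ 2 < X := by
      have := sq_abs Xη
      nlinarith [abs_nonneg Xη]
    have h2 : 2 * |Xη| + 1 < Real.sqrt X := by
      rw [show 2 * |Xη| + 1 = Real.sqrt ((2 * |Xη| + 1) ^ 2) by
        rw [Real.sqrt_sq (by positivity)]]
      exact Real.sqrt_lt_sqrt (by positivity) h1
    linarith [le_abs_self Xη, abs_nonneg Xη]
  -- the `W`-powers
  set w : ℝ := W ^ ((5 : ℝ) / 4) with hw
  have hw0 : 0 < w := Real.rpow_pos_of_pos hW0 _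
  have hwneg : W ^ (-(5 : ℝ) / 4) = 1 / w := by
    rw [hw, show (-(5 : ℝ) / 4) = -((5 : ℝ) / 4) by ring, Real.rpow_neg hW0.le, one_div]
  have hwW2 : w ≤ W ^ 2 := by
    rw [hw, show W ^ 2 = W ^ (2 : ℝ) by norm_num]
    exact Real.rpow_le_rpow_of_exponent_le hW1 (by norm_num)
  -- the uniform error bound
  set Bmax : ℝ := (1 + Mlow) * Real.exp (-Mlow) + 3 / (w * w) with hBmax
  have hBmax0 : 0 ≤ Bmax := by positivity
  have hlogs0 : 0 ≤ Real.log s := Real.log_nonneg (by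
    have : (4 : ℝ) ≤ s := by exact_mod_cast hs4
    linarith)
  have hlogs : Real.log s ≤ W ^ (1 / 5 : ℝ) + 2 := by
    have h1 : Real.log s ≤ Real.log 3 + Real.log L := by
      rw [← Real.log_mul (by norm_num) hL0.ne']; exact Real.log_le_log hs0 hsL'
    have h2 : Real.log 3 ≤ 2 := by
      have := Real.log_le_sub_one_of_pos (show (0:ℝ) < 3 by norm_num); linarith
    linarith
  have herr : ∀ i ∈ Icc 1 I,
      (1 + minPretentiousDistSq f (Y₁ / 2 ^ i) (Y₁ / 2 ^ i)) *
          Real.exp (-minPretentiousDistSq f (Y₁ / 2 ^ i) (Y₁ / 2 ^ i)) +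
        Real.log s ^ (1 / 3 : ℝ) / (Isys.P 1) ^ (1 / 6 - 1 / 20 : ℝ) +
        1 / Real.log (Y₁ / 2 ^ i) ^ (1 / 50 : ℝ) ≤ Bmax := by
    intro i hi
    obtain ⟨hXb1, hXb2, hXb3, -, -⟩ := hXb_range i hi
    rw [hIP, seqP_one, hBmax]
    exact errorTerms_le (by linarith) hMlow (hM _ hXb1 hXb2) hlogs0 hlogs hX0 hXb3 hW125
  -- the A.2 bound on each block
  have hA2block : ∀ i ∈ Icc 1 I,
      ∑ k ∈ Icc (⌈Y₁ / 2 ^ i⌉₊ + 1) ⌊2 * (Y₁ / 2 ^ i)⌋₊,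
        ‖windowSumA2 f Isys (Y₁ / 2 ^ i) s k‖ ^ 2 ≤
        2 * C_A * Bmax * (s : ℝ) ^ 2 * (Y₁ / 2 ^ i) := by
    intro i hi
    obtain ⟨hXb1, hXb2, hXb3, hXb4, hXb5⟩ := hXb_range i hi
    have hXb0 : 0 ≤ Y₁ / 2 ^ i := by positivity
    have h := hdisc (Y₁ / 2 ^ i) (Real.sqrt X₃) s Isys f hf hf1
      (hXηlt.trans_le hXb3) hs4 (Real.sqrt_le_sqrt (by linarith [hY₁X₃])) hXb4
      (by rw [hIQ, seqQ_one]; linarith)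
    refine h.trans ?_
    have h1 := mul_le_mul_of_nonneg_left (herr i hi) (show 0 ≤ 2 * C_A by positivity)
    have h2 := mul_le_mul_of_nonneg_right (mul_le_mul_of_nonneg_right h1 (sq_nonneg (s : ℝ))) hXb0
    exact h2
  -- each block
  have hblock : ∀ i ∈ Icc 1 I,
      ∑ y ∈ Ioc (N i) (N (i - 1)), ‖typWin f P₁ Q₁ (Real.sqrt X₃) Y₁ s y‖ ≤
        2 * Real.sqrt (C_A * Bmax) * s * (Y₁ / 2 ^ i) + s + (s : ℝ) ^ 2 := by
    intro i hi
    obtain ⟨-, -, hXb3, -, hXb5⟩ := hXb_range i hi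
    have hi1 : 1 ≤ i := (Finset.mem_Icc.mp hi).1
    have hXb1 : 1 ≤ Y₁ / 2 ^ i := by
      have : (1 : ℝ) ≤ Real.sqrt X := by
        rw [show (1 : ℝ) = Real.sqrt 1 by simp]; exact Real.sqrt_le_sqrt hX1
      exact this.trans hXb3
    have hN2 : N (i - 1) = ⌊2 * (Y₁ / 2 ^ i)⌋₊ := by
      rw [hN]; dsimp only
      congr 1
      rw [show (2 : ℝ) ^ i = 2 ^ (i - 1) * 2 by rw [← pow_succ, Nat.sub_add_cancel hi1]]
      field_simp
    have hb := block_le hf1 Isys (by norm_num) (by norm_num) hIP hIQ hXb1 hXb5 s (hA2block i hi)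
    rw [hN2]
    refine hb.trans ?_
    have e : Real.sqrt (2 * (Y₁ / 2 ^ i)) * Real.sqrt (2 * C_A * Bmax * (s : ℝ) ^ 2 * (Y₁ / 2 ^ i)) =
        2 * Real.sqrt (C_A * Bmax) * s * (Y₁ / 2 ^ i) := by
      rw [← Real.sqrt_mul (by positivity)]
      rw [show 2 * (Y₁ / 2 ^ i) * (2 * C_A * Bmax * (s : ℝ) ^ 2 * (Y₁ / 2 ^ i)) =
        (C_A * Bmax) * (2 * s * (Y₁ / 2 ^ i)) ^ 2 by ring]
      rw [Real.sqrt_mul (by positivity), Real.sqrt_sq (by positivity)]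
      ring
    rw [e]
  -- sum of the blocks
  have hgeom : ∑ i ∈ Icc 1 I, Y₁ / 2 ^ i ≤ Y₁ := sum_div_two_pow_le hY₁0.le I
  have hblocks : ∑ i ∈ Icc 1 I, ∑ y ∈ Ioc (N i) (N (i - 1)), ‖typWin f P₁ Q₁ (Real.sqrt X₃) Y₁ s y‖ ≤
      2 * Real.sqrt (C_A * Bmax) * s * Y₁ + I * (s + (s : ℝ) ^ 2) := by
    calc ∑ i ∈ Icc 1 I, ∑ y ∈ Ioc (N i) (N (i - 1)), ‖typWin f P₁ Q₁ (Real.sqrt X₃) Y₁ s y‖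
        ≤ ∑ i ∈ Icc 1 I, (2 * Real.sqrt (C_A * Bmax) * s * (Y₁ / 2 ^ i) + s + (s : ℝ) ^ 2) :=
          Finset.sum_le_sum hblock
      _ = 2 * Real.sqrt (C_A * Bmax) * s * ∑ i ∈ Icc 1 I, Y₁ / 2 ^ i + #(Icc 1 I) * (s + (s : ℝ) ^ 2) := by
          rw [Finset.sum_add_distrib, Finset.sum_add_distrib, Finset.mul_sum, Finset.sum_const,
            Finset.sum_const, nsmul_eq_mul, nsmul_eq_mul]
          ring
      _ ≤ 2 * Real.sqrt (C_A * Bmax) * s * Y₁ + I * (s + (s : ℝ) ^ 2) := by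
          rw [Nat.card_Icc, Nat.add_sub_cancel]
          gcongr
  -- the low part
  have hlow : ∑ y ∈ range (N I + 1), ‖typWin f P₁ Q₁ (Real.sqrt X₃) Y₁ s y‖ ≤
      (Y₁ / W ^ 10 + 1) * s := by
    calc ∑ y ∈ range (N I + 1), ‖typWin f P₁ Q₁ (Real.sqrt X₃) Y₁ s y‖
        ≤ ∑ y ∈ range (N I + 1), (s : ℝ) := Finset.sum_le_sum fun y _ => norm_typWin_le hf1 _ _ _ _ s y
      _ = (N I + 1) * s := by rw [Finset.sum_const, card_range, nsmul_eq_mul]; push_cast; ring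
      _ ≤ (Y₁ / W ^ 10 + 1) * s := by
          gcongr
          calc (N I : ℝ) ≤ Y₁ / 2 ^ I := Nat.floor_le (by positivity)
            _ ≤ Y₁ / W ^ 10 := div_le_div_of_nonneg_left hY₁0.le (by positivity) h2I_low.le
  -- assemble
  have htot : winL1 (typFun f P₁ Q₁ (Real.sqrt X₃) Y₁) s ⌊Y₁⌋₊ ≤
      2 * Real.sqrt (C_A * Bmax) * s * Y₁ + I * (s + (s : ℝ) ^ 2) + (Y₁ / W ^ 10 + 1) * s := by
    unfold winL1
    simp_rw [sum_Ioc_typFun]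
    rw [← hN0, sum_range_eq_low_add_blocks _ N hNanti I]
    linarith [hblocks, hlow]
  refine htot.trans ?_
  rw [hwneg]
  have hY₁w : w ≤ Y₁ := by
    refine hwW2.trans (le_trans ?_ hY₁low)
    rw [le_div_iff₀ (by positivity)]
    calc W ^ 2 * W ^ 2 = W ^ 4 := by ring
      _ ≤ W ^ 125 := pow_le_pow_right₀ hW1 (by norm_num)
      _ ≤ Real.log X := hW125
      _ ≤ X := (Real.log_le_sub_one_of_pos hX0).trans (by linarith)
  have hsY : 4 * W ^ 12 * (s : ℝ) ≤ Y₁ := by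
    calc 4 * W ^ 12 * (s : ℝ) ≤ (12 * W ^ 12) * L := by nlinarith [pow_pos hW0 12]
      _ ≤ W ^ 13 * L := by
          have : (12 : ℝ) * W ^ 12 ≤ W ^ 13 := by nlinarith [pow_pos hW0 12]
          exact mul_le_mul_of_nonneg_right this (Nat.cast_nonneg L)
      _ = (L * W ^ 15) / W ^ 2 := by field_simp
      _ ≤ X / W ^ 2 := div_le_div_of_nonneg_right hLX (by positivity)
      _ ≤ Y₁ := hY₁low
  have hs1 : (1 : ℝ) ≤ s := by
    have : (4 : ℝ) ≤ s := by exact_mod_cast hs4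
    linarith
  have hfin := final_numerics (E := (1 + Mlow) * Real.exp (-Mlow)) hC_A0 (by positivity) hw0 hW1 hwW2 hs1
    hY₁0 hIle hY₁w hsY
  exact hfin

/-! ### Twisting by a Dirichlet character and the non-pretentiousness at lower heights -/

/-- `conj χ(a) = χ⁻¹(a)` for a Dirichlet character with values in `ℂ`. [folklore] -/
theorem conj_dirichletChar_apply {q : ℕ} (χ : DirichletCharacter ℂ q) (a : ZMod q) :
    (starRingEnd ℂ) (χ a) = χ⁻¹ a := by
  rw [MulChar.inv_apply_eq_inv']
  by_cases ha : IsUnit a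
  · obtain ⟨u, rfl⟩ := ha
    have h1 : ‖χ u‖ = 1 := χ.unit_norm_eq_one u
    rw [Complex.inv_def, Complex.normSq_eq_norm_sq, h1]
    simp
  · rw [MulChar.map_nonunit χ ha]; simp

/-- The twist `n ↦ g(n) χ(n)` of an arithmetic function by a Dirichlet character.
[cite: MatomakiRadziwillTao2015, §4] -/
def twistChar (g : ArithmeticFunction ℂ) {q : ℕ} (χ : DirichletCharacter ℂ q) :
    ArithmeticFunction ℂ :=
  ⟨fun n => g n * χ (n : ZMod q), by simp⟩

/-- Unfolding `twistChar`. [folklore] -/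
theorem twistChar_apply (g : ArithmeticFunction ℂ) {q : ℕ} (χ : DirichletCharacter ℂ q) (n : ℕ) :
    twistChar g χ n = g n * χ (n : ZMod q) := rfl

/-- The twist of a completely multiplicative `g` is multiplicative. [folklore] -/
theorem isMultiplicative_twistChar {g : ArithmeticFunction ℂ}
    (hg : ∀ m n : ℕ, g (m * n) = g m * g n) (hg1 : g 1 = 1) {q : ℕ} (χ : DirichletCharacter ℂ q) :
    (twistChar g χ).IsMultiplicative := by
  refine ⟨by simp [twistChar_apply, hg1], fun {m n} _ => ?_⟩
  simp only [twistChar_apply, Nat.cast_mul, map_mul, hg]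
  ring

/-- `‖g χ‖ ≤ 1` for `1`-bounded `g`. [folklore] -/
theorem norm_twistChar_le {g : ArithmeticFunction ℂ} (hg : ∀ n, ‖g n‖ ≤ 1) {q : ℕ}
    (χ : DirichletCharacter ℂ q) (n : ℕ) : ‖twistChar g χ n‖ ≤ 1 := by
  rw [twistChar_apply, norm_mul]
  calc ‖g n‖ * ‖χ (n : ZMod q)‖ ≤ 1 * 1 := mul_le_mul (hg n) (χ.norm_le_one _) (norm_nonneg _) zero_le_one
    _ = 1 := one_mul 1

/-- `𝔻(g χ, n^{it}; x)² = 𝔻(g, χ⁻¹(n) n^{it}; x)²`. [cite: MatomakiRadziwillTao2015, §4] -/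
theorem pretentiousDistSq_twistChar (g : ArithmeticFunction ℂ) {q : ℕ} (χ : DirichletCharacter ℂ q)
    (t x : ℝ) :
    Sieve.pretentiousDistSq (twistChar g χ) (fun n : ℕ => (n : ℂ) ^ ((t : ℝ) * Complex.I)) x =
      Sieve.pretentiousDistSq g (Sieve.twistedChar χ⁻¹ t) x := by
  unfold Sieve.pretentiousDistSq
  refine Finset.sum_congr rfl fun p _ => ?_
  congr 3
  rw [twistChar_apply, Sieve.twistedChar, map_mul, ← conj_dirichletChar_apply, Complex.conj_conj]
  ring

/-- **Non-pretentiousness of `g χ` at lower heights from that of `g` at height `X`**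
([MRT2015, §4]: "From Mertens' theorem and definition of `M(g, X, W)`,
`M(g χ̄; X') ≥ M(g χ̄; X) - O(1) ≥ M(g, X, W) - O(1)`"): for `χ` of modulus `q ≤ W`, `W ≥ 1`,
and `√X ≤ X_b ≤ X`, `X_b ≥ 4`: `M(gχ; X_b) ≥ M(g; X, W) - 48`.
[cite: MatomakiRadziwillTao2015, §4] -/
theorem minPretentiousDistSq_twistChar_ge {g : ArithmeticFunction ℂ} (hg : ∀ n, ‖g n‖ ≤ 1) {q : ℕ}
    (hq : 1 ≤ q) (χ : DirichletCharacter ℂ q) {X Xb W : ℝ} (hqW : (q : ℝ) ≤ W) (hXb4 : 4 ≤ Xb)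
    (hXbX : Xb ≤ X) (hsqrt : Real.sqrt X ≤ Xb) :
    Sieve.nonpretentiousness g X W - 48 ≤ minPretentiousDistSq (twistChar g χ) Xb Xb := by
  have hX0 : 0 < X := by linarith
  have hXb0 : 0 ≤ Xb := by linarith
  have hlog : Real.log X ≤ 2 * Real.log Xb := by
    have h1 := Real.log_le_log (Real.sqrt_pos.mpr hX0) hsqrt
    rw [Real.log_sqrt hX0.le] at h1; linarith
  have hz : ∀ t : ℝ, ∀ n, ‖Sieve.twistedChar χ⁻¹ t n‖ ≤ 1 := fun t => Sieve.norm_twistedChar_le_one _ _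
  have hbdd : BddBelow (Set.range fun s : Set.Icc (-X) X =>
      Sieve.pretentiousDistSq (⇑g) (Sieve.twistedChar χ⁻¹ (s : ℝ)) X) := by
    refine ⟨0, ?_⟩
    rintro _ ⟨s, rfl⟩
    exact Sieve.pretentiousDistSq_nonneg hg (hz _) X
  have key : ∀ t : ℝ, |t| ≤ Xb → Sieve.nonpretentiousness g X W - 48 ≤
      Sieve.pretentiousDistSq (⇑(twistChar g χ)) (fun n : ℕ => (n : ℂ) ^ ((t : ℂ) * Complex.I)) Xb := by
    intro t ht
    rw [pretentiousDistSq_twistChar]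
    have htX : |t| ≤ X := ht.trans hXbX
    have hw := Tao2016.pretentiousDistSq_window (f := ⇑g) (z := Sieve.twistedChar χ⁻¹ t) hg (hz t) hXb4 hXbX
      (by norm_num : (1 : ℝ) ≤ 2) hlog
    have h1 : Sieve.nonpretentiousness (⇑g) X W ≤ Sieve.charNonpretentiousness (⇑g) χ⁻¹ X :=
      Sieve.nonpretentiousness_le_charNonpretentiousness_holds hg hX0.le hq hqW χ⁻¹
    have h2 : Sieve.charNonpretentiousness (⇑g) χ⁻¹ X ≤ Sieve.pretentiousDistSq (⇑g) (Sieve.twistedChar χ⁻¹ t) X :=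
      ciInf_le hbdd ⟨t, abs_le.mp htX⟩
    linarith
  unfold Sieve.minPretentiousDistSq
  haveI : Nonempty (Set.Icc (-Xb) Xb) := ⟨⟨0, by simp [hXb0]⟩⟩
  exact le_ciInf fun t => key t (abs_le.mpr ⟨t.2.1, t.2.2⟩)

/-! ### The estimate for one residue class -/

/-- `typFun` at a multiple `d₀ m'` of a number with small prime factors: for `g` completely
multiplicative, `1_{𝒮_{…,Y}}(d₀m') g(d₀m') = g(d₀) 1_{𝒮_{…,Y/d₀}}(m') g(m')`.
[cite: MatomakiRadziwillTao2015, §4] -/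
theorem typFun_mul {g : ℕ → ℂ} (hg : ∀ m n : ℕ, g (m * n) = g m * g n) {P₁ Q₁ X₀ Y : ℝ}
    {d₀ : ℕ} (hd₀ : 0 < d₀) (hP : 1 < P₁) (hQ : 1 ≤ Real.log Q₁)
    (hsmall : ∀ p : ℕ, p.Prime → p ∣ d₀ → (p : ℝ) < P₁) (m : ℕ) :
    typFun g P₁ Q₁ X₀ Y (d₀ * m) = g d₀ * typFun g P₁ Q₁ X₀ (Y / d₀) m := by
  unfold typFun
  by_cases h : m ∈ typicalSet P₁ Q₁ X₀ (Y / d₀)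
  · rw [if_pos h, if_pos ((mul_mem_typicalSet_iff hd₀ hP hQ hsmall).mpr h), hg]
  · rw [if_neg h, if_neg (fun h' => h ((mul_mem_typicalSet_iff hd₀ hP hQ hsmall).mp h')), mul_zero]

/-- **One residue class** ([MRT2015, §4]): for `b < q ≤ W` and window length `j`,
`winL1 (1_{m ≡ b (q)} 1_{𝒮'} g) j Y ≤ d₀ ∑_{s' ∈ {⌊j/d₀⌋, ⌊j/d₀⌋+1}} (1/φ(q₀)) ∑_χ winL1 (1_{𝒮'_{d₀}} g χ) s' ⌊Y/d₀⌋`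
with `d₀ = (b, q)`, `q₀ = q/d₀`. [cite: MatomakiRadziwillTao2015, §4] -/
theorem class_le {g : ArithmeticFunction ℂ} (hg : ∀ m n : ℕ, g (m * n) = g m * g n)
    (hg1 : ∀ n, ‖g n‖ ≤ 1) {P₁ Q₁ X₀ Y : ℝ} (hP : 1 < P₁) (hQ : 1 ≤ Real.log Q₁)
    {q b : ℕ} (hq : 0 < q) (hb : b < q) (hqP : (q : ℝ) < P₁) (j Yn : ℕ) :
    winL1 (fun m => if m % q = b then typFun g P₁ Q₁ X₀ Y m else 0) j Yn ≤
      Nat.gcd b q * ∑ s' ∈ ({j / Nat.gcd b q, j / Nat.gcd b q + 1} : Finset ℕ),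
        (1 / ((q / Nat.gcd b q).totient : ℝ)) *
          ∑ χ : DirichletCharacter ℂ (q / Nat.gcd b q),
            winL1 (typFun (twistChar g χ) P₁ Q₁ X₀ (Y / Nat.gcd b q)) s' (Yn / Nat.gcd b q) := by
  set d₀ := Nat.gcd b q with hd₀
  set q₀ := q / d₀ with hq₀
  set b₀ := b / d₀ with hb₀
  have hd₀pos : 0 < d₀ := Nat.gcd_pos_of_pos_right _ hq
  have hd₀q : d₀ ∣ q := Nat.gcd_dvd_right b q
  have hq₀pos : 0 < q₀ := Nat.div_pos (Nat.le_of_dvd hq hd₀q) hd₀pos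
  have hcop : Nat.Coprime b₀ q₀ := by
    rw [hb₀, hq₀, hd₀]; exact Nat.coprime_div_gcd_div_gcd hd₀pos
  have hsmall : ∀ p : ℕ, p.Prime → p ∣ d₀ → (p : ℝ) < P₁ := by
    intro p hp hpd
    have : p ≤ q := Nat.le_of_dvd hq (hpd.trans hd₀q)
    exact lt_of_le_of_lt (by exact_mod_cast this) hqP
  -- Step 1: pass to `m = d₀ m'`
  set c' : ℕ → ℂ := fun m' => if m' % q₀ = b₀ % q₀ then typFun g P₁ Q₁ X₀ (Y / d₀) m' else 0 with hc'
  have hstep1 : winL1 (fun m => if m % q = b then typFun g P₁ Q₁ X₀ Y m else 0) j Yn ≤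
      d₀ * (winL1 c' (j / d₀) (Yn / d₀) + winL1 c' (j / d₀ + 1) (Yn / d₀)) := by
    have hb₀lt : b₀ % q₀ = b₀ := Nat.mod_eq_of_lt (by
      rw [hb₀, hq₀]
      obtain ⟨q₁, hq₁⟩ := hd₀q
      have hbd : d₀ ∣ b := Nat.gcd_dvd_left b q
      obtain ⟨b₁, hb₁⟩ := hbd
      rw [hq₁, hb₁, Nat.mul_div_cancel_left _ hd₀pos, Nat.mul_div_cancel_left _ hd₀pos]
      rw [hq₁, hb₁] at hb
      exact Nat.lt_of_mul_lt_mul_left hb)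
    have key : ∀ y, ∑ m ∈ Ioc y (y + j), (if m % q = b then typFun g P₁ Q₁ X₀ Y m else 0) =
        g d₀ * ∑ m' ∈ Ioc (y / d₀) ((y + j) / d₀), c' m' := by
      intro y
      rw [← Finset.sum_filter, sum_filter_mod_eq_sum_div _ hq hb, Finset.mul_sum, hc']
      dsimp only
      rw [← hd₀, ← hq₀, ← hb₀, Finset.sum_filter]
      refine Finset.sum_congr rfl fun m' _ => ?_
      rw [hb₀lt]
      by_cases h : m' % q₀ = b₀
      · simp only [h, if_true, typFun_mul hg hd₀pos hP hQ hsmall]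
      · simp only [h, if_false, mul_zero]
    unfold winL1
    calc ∑ y ∈ range (Yn + 1), ‖∑ m ∈ Ioc y (y + j), (if m % q = b then typFun g P₁ Q₁ X₀ Y m else 0)‖
        = ∑ y ∈ range (Yn + 1), ‖g d₀‖ * ‖∑ m' ∈ Ioc (y / d₀) ((y + j) / d₀), c' m'‖ := by
          refine Finset.sum_congr rfl fun y _ => ?_
          rw [key, norm_mul]
      _ ≤ ∑ y ∈ range (Yn + 1), ‖∑ m' ∈ Ioc (y / d₀) ((y + j) / d₀), c' m'‖ := by
          refine Finset.sum_le_sum fun y _ => ?_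
          calc ‖g d₀‖ * ‖∑ m' ∈ Ioc (y / d₀) ((y + j) / d₀), c' m'‖
              ≤ 1 * ‖∑ m' ∈ Ioc (y / d₀) ((y + j) / d₀), c' m'‖ :=
                mul_le_mul_of_nonneg_right (hg1 d₀) (norm_nonneg _)
            _ = _ := one_mul _
      _ ≤ _ := sum_norm_win_div_le c' hd₀pos j Yn
  refine hstep1.trans ?_
  rw [Finset.sum_pair (by omega)]
  have hchars : ∀ s' : ℕ, winL1 c' s' (Yn / d₀) ≤ (1 / (q₀.totient : ℝ)) *
      ∑ χ : DirichletCharacter ℂ q₀, winL1 (typFun (twistChar g χ) P₁ Q₁ X₀ (Y / d₀)) s' (Yn / d₀) := by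
    intro s'
    unfold winL1
    rw [Finset.mul_sum]
    simp_rw [Finset.mul_sum]
    rw [Finset.sum_comm]
    refine Finset.sum_le_sum fun y _ => ?_
    rw [← Finset.mul_sum]
    have e1 : ∑ m ∈ Ioc y (y + s'), c' m =
        ∑ m ∈ (Ioc y (y + s')).filter (fun m => m % q₀ = b₀ % q₀), typFun g P₁ Q₁ X₀ (Y / d₀) m := by
      rw [hc', Finset.sum_filter]
    rw [e1]
    refine (norm_sum_filter_mod_le_sum_chars hq₀pos hcop _ _).trans (le_of_eq ?_)
    congr 1
    refine Finset.sum_congr rfl fun χ _ => ?_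
    congr 1
    refine Finset.sum_congr rfl fun m _ => ?_
    unfold typFun
    rw [twistChar_apply]
    split_ifs <;> ring
  exact mul_le_mul_of_nonneg_left (add_le_add (hchars _) (hchars _)) (Nat.cast_nonneg d₀)

/-- The number of Dirichlet characters mod `q₀` (as a real number) is `φ(q₀)`. [folklore] -/
theorem card_dirichletChar_eq (q₀ : ℕ) [NeZero q₀] :
    (#(Finset.univ : Finset (DirichletCharacter ℂ q₀)) : ℝ) = q₀.totient := by
  rw [Finset.card_univ, ← Nat.card_eq_fintype_card,
    DirichletCharacter.card_eq_totient_of_hasEnoughRootsOfUnity ℂ q₀]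

/-- **All residue classes** ([MRT2015, §4]): if every character twist obeys the bound
`winL1 (1_{𝒮'_{d d₀}} g χ) s' ⌊X₃/(d d₀)⌋ ≤ K s' X₃/(d d₀)` (`d₀ ≤ q`, `s' ∈ {⌊j/d₀⌋, ⌊j/d₀⌋+1}`),
then `winL1 (1_{𝒮'_d} g · e(a ·/q)) j ⌊X₃/d⌋ ≤ q K X₃ (2j + 2) / d`.
[cite: MatomakiRadziwillTao2015, §4] -/
theorem unitScale_class_le {g : ArithmeticFunction ℂ} (hg : ∀ m n : ℕ, g (m * n) = g m * g n)
    (hg1 : ∀ n, ‖g n‖ ≤ 1) {P₁ Q₁ X₀ X₃ K : ℝ} (hP : 1 < P₁) (hQ : 1 ≤ Real.log Q₁)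
    (hX₃ : 0 ≤ X₃) (hK : 0 ≤ K) {q d j : ℕ} (hq : 0 < q) (hqP : (q : ℝ) < P₁) (hd : 0 < d) (a : ℤ)
    (hL6 : ∀ d₀ : ℕ, 1 ≤ d₀ → d₀ ≤ q → ∀ q₀ : ℕ, 1 ≤ q₀ → q₀ ≤ q →
      ∀ χ : DirichletCharacter ℂ q₀, ∀ s' ∈ ({j / d₀, j / d₀ + 1} : Finset ℕ),
        winL1 (typFun (twistChar g χ) P₁ Q₁ X₀ (X₃ / d / d₀)) s' (⌊X₃⌋₊ / d / d₀) ≤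
          K * s' * (X₃ / (d * d₀))) :
    winL1 (fun m => typFun g P₁ Q₁ X₀ (X₃ / d) m * (𝐞 ((a : ℝ) * m / q) : ℂ)) j (⌊X₃⌋₊ / d) ≤
      q * K * X₃ * (2 * j + 2) / d := by
  refine (winL1_residue_le _ a hq j _).trans ?_
  have hclass : ∀ b ∈ range q,
      winL1 (fun m => if m % q = b then typFun g P₁ Q₁ X₀ (X₃ / d) m else 0) j (⌊X₃⌋₊ / d) ≤
        K * X₃ * (2 * j + 2) / d := by
    intro b hb
    rw [Finset.mem_range] at hb
    refine (class_le hg hg1 hP hQ hq hb hqP j _).trans ?_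
    set d₀ := Nat.gcd b q with hd₀
    set q₀ := q / d₀ with hq₀
    have hd₀pos : 0 < d₀ := Nat.gcd_pos_of_pos_right _ hq
    have hd₀q : d₀ ≤ q := Nat.le_of_dvd hq (Nat.gcd_dvd_right b q)
    have hq₀pos : 0 < q₀ := Nat.div_pos hd₀q hd₀pos
    have hq₀q : q₀ ≤ q := Nat.div_le_self q d₀
    haveI : NeZero q₀ := ⟨hq₀pos.ne'⟩
    have htot : (0 : ℝ) < q₀.totient := by exact_mod_cast Nat.totient_pos.mpr hq₀pos
    have hd₀r : (0 : ℝ) < d₀ := by exact_mod_cast hd₀pos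
    have hdr : (0 : ℝ) < d := by exact_mod_cast hd
    -- each `s'`
    have hs' : ∀ s' ∈ ({j / d₀, j / d₀ + 1} : Finset ℕ),
        (1 / (q₀.totient : ℝ)) * ∑ χ : DirichletCharacter ℂ q₀,
          winL1 (typFun (twistChar g χ) P₁ Q₁ X₀ (X₃ / d / d₀)) s' (⌊X₃⌋₊ / d / d₀) ≤
          K * s' * (X₃ / (d * d₀)) := by
      intro s' hs'
      calc (1 / (q₀.totient : ℝ)) * ∑ χ : DirichletCharacter ℂ q₀,
            winL1 (typFun (twistChar g χ) P₁ Q₁ X₀ (X₃ / d / d₀)) s' (⌊X₃⌋₊ / d / d₀)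
          ≤ (1 / (q₀.totient : ℝ)) * ∑ _χ : DirichletCharacter ℂ q₀, K * s' * (X₃ / (d * d₀)) :=
            mul_le_mul_of_nonneg_left (Finset.sum_le_sum fun χ _ =>
              hL6 d₀ hd₀pos hd₀q q₀ hq₀pos hq₀q χ s' hs') (by positivity)
        _ = K * s' * (X₃ / (d * d₀)) := by
            rw [Finset.sum_const, nsmul_eq_mul, card_dirichletChar_eq]
            field_simp
    have e1 : X₃ / d / d₀ = X₃ / (d * d₀) := by rw [div_div]
    rw [Finset.sum_pair (by omega)]
    have h1 := hs' (j / d₀) (by simp)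
    have h2 := hs' (j / d₀ + 1) (by simp)
    calc (d₀ : ℝ) * ((1 / (q₀.totient : ℝ)) * ∑ χ : DirichletCharacter ℂ q₀,
            winL1 (typFun (twistChar g χ) P₁ Q₁ X₀ (X₃ / d / d₀)) (j / d₀) (⌊X₃⌋₊ / d / d₀) +
          (1 / (q₀.totient : ℝ)) * ∑ χ : DirichletCharacter ℂ q₀,
            winL1 (typFun (twistChar g χ) P₁ Q₁ X₀ (X₃ / d / d₀)) (j / d₀ + 1) (⌊X₃⌋₊ / d / d₀))
        ≤ d₀ * (K * ((j / d₀ : ℕ) : ℝ) * (X₃ / (d * d₀)) + K * ((j / d₀ + 1 : ℕ) : ℝ) * (X₃ / (d * d₀))) :=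
          mul_le_mul_of_nonneg_left (add_le_add h1 h2) hd₀r.le
      _ = K * X₃ * (((j / d₀ : ℕ) : ℝ) + ((j / d₀ + 1 : ℕ) : ℝ)) / d := by
          field_simp
      _ ≤ K * X₃ * (2 * j + 2) / d := by
          refine div_le_div_of_nonneg_right (mul_le_mul_of_nonneg_left ?_ (by positivity)) hdr.le
          have : ((j / d₀ : ℕ) : ℝ) ≤ j := by exact_mod_cast Nat.div_le_self j d₀
          push_cast
          linarith
  calc ∑ b ∈ range q, winL1 (fun m => if m % q = b then typFun g P₁ Q₁ X₀ (X₃ / d) m else 0) j (⌊X₃⌋₊ / d)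
      ≤ ∑ b ∈ range q, K * X₃ * (2 * j + 2) / d := Finset.sum_le_sum hclass
    _ = q * K * X₃ * (2 * j + 2) / d := by
        rw [Finset.sum_const, card_range, nsmul_eq_mul]; ring

/-! ### Assembly of the major arc estimate -/

/-- `√((1+M) e^{-M}) ≤ 3 e^{24} W^{-5/4}` for `M = 3 log W - 48` (`W ≥ 1`, `M ≥ 0`). [folklore] -/
theorem sqrt_exp_neg_Mlow_le {W : ℝ} (hW : 1 ≤ W) (hM : 0 ≤ 3 * Real.log W - 48) :
    Real.sqrt ((1 + (3 * Real.log W - 48)) * Real.exp (-(3 * Real.log W - 48))) ≤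
      3 * Real.exp 24 * W ^ (-(5 : ℝ) / 4) := by
  have hW0 : 0 < W := by linarith
  have hexp : Real.exp (-(3 * Real.log W - 48)) = Real.exp 48 / W ^ 3 := by
    rw [show -(3 * Real.log W - 48) = 48 - 3 * Real.log W by ring, Real.exp_sub,
      show 3 * Real.log W = Real.log (W ^ 3) by rw [Real.log_pow]; push_cast; ring,
      Real.exp_log (by positivity)]
  have hsqrt1 : 1 ≤ Real.sqrt W := by
    rw [show (1 : ℝ) = Real.sqrt 1 by simp]; exact Real.sqrt_le_sqrt hW
  have hM7 : 1 + (3 * Real.log W - 48) ≤ 7 * Real.sqrt W := by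
    have hlog2 : Real.log W ≤ 2 * Real.sqrt W := by
      have h1 : Real.log W = 2 * Real.log (Real.sqrt W) := by
        rw [Real.log_sqrt hW0.le]; ring
      rw [h1]
      have := Real.log_le_sub_one_of_pos (Real.sqrt_pos.mpr hW0)
      linarith
    linarith
  have hprod : (1 + (3 * Real.log W - 48)) * Real.exp (-(3 * Real.log W - 48)) ≤
      7 * Real.exp 48 * (Real.sqrt W / W ^ 3) := by
    rw [hexp]
    calc (1 + (3 * Real.log W - 48)) * (Real.exp 48 / W ^ 3) ≤ 7 * Real.sqrt W * (Real.exp 48 / W ^ 3) :=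
          mul_le_mul_of_nonneg_right hM7 (by positivity)
      _ = 7 * Real.exp 48 * (Real.sqrt W / W ^ 3) := by ring
  -- `√W / W³ = W^{-5/2}` and `√(W^{-5/2}) = W^{-5/4}`
  have hpow : Real.sqrt W / W ^ 3 = W ^ (-(5 : ℝ) / 2) := by
    rw [Real.sqrt_eq_rpow, show W ^ 3 = W ^ (3 : ℝ) by norm_num, ← Real.rpow_sub hW0]
    norm_num
  rw [hpow] at hprod
  have htarget : (3 * Real.exp 24 * W ^ (-(5 : ℝ) / 4)) ^ 2 = 9 * Real.exp 48 * W ^ (-(5 : ℝ) / 2) := by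
    have e1 : (W ^ (-(5 : ℝ) / 4)) ^ 2 = W ^ (-(5 : ℝ) / 2) := by
      rw [← Real.rpow_natCast, ← Real.rpow_mul hW0.le]; norm_num
    have e2 : Real.exp 24 ^ 2 = Real.exp 48 := by
      rw [← Real.exp_nat_mul]; norm_num
    rw [mul_pow, mul_pow, e1, e2]; norm_num
  rw [Real.sqrt_le_left (by positivity), htarget]
  have : 0 ≤ Real.exp 48 * W ^ (-(5 : ℝ) / 2) := by positivity
  linarith

set_option maxHeartbeats 1600000 in
/-- **The per-character input of the major arc estimate**: from `winL1_typical_le` (in the form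
of its conclusion `h6`) and the non-pretentiousness hypothesis `3 log W ≤ M(g; X, W)`: for
every `d₀ ≤ q ≤ W`, modulus `q₀ ≤ q`, character `χ (mod q₀)` and window length
`s' ∈ {⌊j/d₀⌋, ⌊j/d₀⌋ + 1}` with `2L/W² < j ≤ 2L/d + 1`,
`winL1 (1_{𝒮'_{dd₀}} gχ) s' ⌊X₃/(dd₀)⌋ ≤ C₆ (3e^{24} + 1) W^{-5/4} s' X₃/(d d₀)`
(`√((1+M_low)e^{-M_low}) ≤ 3e^{24} W^{-5/4}` for `M_low = 3 log W - 48`).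
[cite: MatomakiRadziwillTao2015, §4] -/
theorem perChar_bound {C₆ W₀ Xs : ℝ} (hC₆ : 0 < C₆)
    (h6 : ∀ (X X₃ W : ℝ) (L d₁ s : ℕ) (f : ArithmeticFunction ℂ) (Mlow : ℝ),
      f.IsMultiplicative → (∀ n, ‖f n‖ ≤ 1) →
      Xs ≤ X → X ≤ X₃ → X₃ ≤ 2 * X → W₀ ≤ W → W ≤ Real.log X ^ (1 / 125 : ℝ) →
      1 ≤ d₁ → (d₁ : ℝ) < W ^ 2 →
      W ^ 203 ≤ (L : ℝ) → (L : ℝ) * W ^ 15 ≤ X → (L : ℝ) ≤ Real.exp (Real.sqrt (Real.log X / 2)) →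
      Real.log L ^ 5 ≤ W → (L : ℝ) / W ^ 3 + 1 / 2 ≤ s → (s : ℝ) ≤ 3 * L →
      1 ≤ Mlow → (∀ Xb : ℝ, X₃ / (4 * d₁ * W ^ 10) ≤ Xb → Xb ≤ X → Mlow ≤ minPretentiousDistSq f Xb Xb) →
      winL1 (typFun f (W ^ 200) (L / W ^ 3) (Real.sqrt X₃) (X₃ / d₁)) s ⌊X₃ / d₁⌋₊ ≤
        C₆ * s * (X₃ / d₁) * (Real.sqrt ((1 + Mlow) * Real.exp (-Mlow)) + W ^ (-(5 : ℝ) / 4)))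
    {X X₃ W : ℝ} {L d q j : ℕ} {g : ArithmeticFunction ℂ}
    (hg : ∀ m n : ℕ, g (m * n) = g m * g n) (hg1' : g 1 = 1) (hg1 : ∀ n, ‖g n‖ ≤ 1)
    (hXs : Xs ≤ X) (hXX₃ : X ≤ X₃) (hX₃ : X₃ ≤ 2 * X) (hW₀ : W₀ ≤ W) (hW17 : Real.exp 17 ≤ W)
    (hWX : W ≤ Real.log X ^ (1 / 125 : ℝ)) (hd : 1 ≤ d) (hdW : (d : ℝ) < W)
    (hqW : (q : ℝ) ≤ W) (hWL : W ^ 203 ≤ (L : ℝ)) (hLX : (L : ℝ) * W ^ 15 ≤ X)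
    (hLexp : (L : ℝ) ≤ Real.exp (Real.sqrt (Real.log X / 2))) (hlogL : Real.log L ^ 5 ≤ W)
    (hM : 3 * Real.log W ≤ Sieve.nonpretentiousness g X W)
    (hjlow : 2 * (L : ℝ) / W ^ 2 < j) (hjup : (j : ℝ) ≤ 2 * L / d + 1) :
    ∀ d₀ : ℕ, 1 ≤ d₀ → d₀ ≤ q → ∀ q₀ : ℕ, 1 ≤ q₀ → q₀ ≤ q →
      ∀ χ : DirichletCharacter ℂ q₀, ∀ s' ∈ ({j / d₀, j / d₀ + 1} : Finset ℕ),
        winL1 (typFun (twistChar g χ) (W ^ 200) (L / W ^ 3) (Real.sqrt X₃) (X₃ / d / d₀)) s'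
            (⌊X₃⌋₊ / d / d₀) ≤
          (C₆ * (3 * Real.exp 24 + 1) * W ^ (-(5 : ℝ) / 4)) * s' * (X₃ / (d * d₀)) := by
  intro d₀ hd₀ hd₀q q₀ hq₀ hq₀q χ s' hs'
  -- basic facts
  have hW2 : (2 : ℝ) ≤ W := le_trans (by have := Real.add_one_le_exp (17 : ℝ); linarith) hW17
  have hW1 : (1 : ℝ) ≤ W := by linarith
  have hW0 : 0 < W := by linarith
  have hlogW : 17 ≤ Real.log W := by
    have := Real.log_le_log (Real.exp_pos _) hW17; rwa [Real.log_exp] at this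
  have hL1 : (1 : ℝ) ≤ L := le_trans (one_le_pow₀ hW1) hWL
  have hL0 : (0 : ℝ) < L := by linarith
  have hX1 : (1 : ℝ) ≤ X := by
    have : (1 : ℝ) * 1 ≤ (L : ℝ) * W ^ 15 := mul_le_mul hL1 (one_le_pow₀ hW1) zero_le_one hL0.le
    linarith
  have hX0 : 0 < X := by linarith
  have hd0 : (0 : ℝ) < d := by exact_mod_cast hd
  have hd1 : (1 : ℝ) ≤ d := by exact_mod_cast hd
  have hd₀0 : (0 : ℝ) < d₀ := by exact_mod_cast hd₀
  have hd₀W : (d₀ : ℝ) ≤ W := le_trans (by exact_mod_cast hd₀q) hqW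
  have hq₀W : (q₀ : ℝ) ≤ W := le_trans (by exact_mod_cast hq₀q) hqW
  set Mlow : ℝ := 3 * Real.log W - 48 with hMlow
  have hMlow1 : 1 ≤ Mlow := by rw [hMlow]; linarith
  -- `d₁ = d d₀ < W²`
  have hd₁ : 1 ≤ d * d₀ := Nat.mul_le_mul hd hd₀
  have hd₁W : ((d * d₀ : ℕ) : ℝ) < W ^ 2 := by
    push_cast
    calc (d : ℝ) * d₀ < W * d₀ := mul_lt_mul_of_pos_right hdW hd₀0
      _ ≤ W * W := mul_le_mul_of_nonneg_left hd₀W hW0.le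
      _ = W ^ 2 := (sq W).symm
  -- the window length `s'`
  rw [Finset.mem_insert, Finset.mem_singleton] at hs'
  have hs'ge : (j : ℝ) / d₀ - 1 ≤ s' := by
    have h : (j : ℝ) / d₀ - 1 ≤ ((j / d₀ : ℕ) : ℝ) := by
      have hd₀0 : (0 : ℝ) < d₀ := by exact_mod_cast hd₀
      have h1 : (j : ℝ) < ((j / d₀ : ℕ) : ℝ) * d₀ + d₀ := by exact_mod_cast Nat.lt_div_mul_add hd₀
      have h2 : (j : ℝ) / d₀ < ((j / d₀ : ℕ) : ℝ) + 1 := by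
        rw [div_lt_iff₀ hd₀0]; linarith
      linarith
    rcases hs' with rfl | rfl
    · exact h
    · push_cast; linarith
  have hs'le : (s' : ℝ) ≤ j + 1 := by
    have h : ((j / d₀ : ℕ) : ℝ) ≤ j := by exact_mod_cast Nat.div_le_self j d₀
    rcases hs' with rfl | rfl
    · linarith
    · push_cast; linarith
  have hs'low : (L : ℝ) / W ^ 3 + 1 / 2 ≤ s' := by
    have h2 : 2 * ((L : ℝ) / W ^ 3) ≤ (j : ℝ) / d₀ := by
      rw [le_div_iff₀ hd₀0]
      calc 2 * ((L : ℝ) / W ^ 3) * d₀ ≤ 2 * (L / W ^ 3) * W := by gcongr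
        _ = 2 * L / W ^ 2 := by field_simp
        _ ≤ j := hjlow.le
    have h3 : (3 : ℝ) / 2 ≤ (L : ℝ) / W ^ 3 := by
      rw [le_div_iff₀ (by positivity)]
      calc 3 / 2 * W ^ 3 ≤ W * W ^ 3 := by gcongr; linarith
        _ = W ^ 4 := by ring
        _ ≤ W ^ 203 := pow_le_pow_right₀ hW1 (by norm_num)
        _ ≤ L := hWL
    linarith
  have hs'up : (s' : ℝ) ≤ 3 * L := by
    have h2 : 2 * (L : ℝ) / d ≤ 2 * L := div_le_self (by positivity) hd1
    have h3 : (2 : ℝ) ≤ L := by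
      have : (2 : ℝ) ≤ W ^ 203 := le_trans hW2 (le_self_pow₀ hW1 (by norm_num))
      exact this.trans hWL
    linarith
  -- non-pretentiousness at the dyadic heights
  have hlogX0 : 0 ≤ Real.log X := Real.log_nonneg hX1
  have hW125 : W ^ (125 : ℕ) ≤ Real.log X := by
    have h := Real.rpow_le_rpow hW0.le hWX (by norm_num : (0 : ℝ) ≤ 125)
    rw [← Real.rpow_mul hlogX0, show (1 / 125 : ℝ) * 125 = 1 by norm_num, Real.rpow_one,
      show (125 : ℝ) = (125 : ℕ) by norm_num, Real.rpow_natCast] at h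
    exact h
  have hW16 : (16 : ℝ) ≤ W := le_trans (by have := Real.add_one_le_exp (17 : ℝ); linarith) hW17
  have hX16 : 16 ≤ Real.log X := by
    have : (16 : ℝ) ≤ W ^ 125 := le_trans hW16 (le_self_pow₀ hW1 (by norm_num))
    exact this.trans hW125
  have hsqrtX : 2 * Real.log X ≤ Real.sqrt X := two_mul_log_le_sqrt hX0 hX16
  have hW12 : 4 * W ^ 12 ≤ Real.sqrt X := by
    have h1 : 4 * W ^ 12 ≤ W ^ 14 := by
      have h4 : (4 : ℝ) ≤ W ^ 2 := by nlinarith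
      calc 4 * W ^ 12 = W ^ 12 * 4 := by ring
        _ ≤ W ^ 12 * W ^ 2 := mul_le_mul_of_nonneg_left h4 (by positivity)
        _ = W ^ 14 := by ring
    have h2 : W ^ (14 : ℕ) ≤ Real.log X := le_trans (pow_le_pow_right₀ hW1 (by norm_num)) hW125
    linarith
  have hMd : ∀ Xb : ℝ, X₃ / (4 * ((d * d₀ : ℕ) : ℝ) * W ^ 10) ≤ Xb → Xb ≤ X →
      Mlow ≤ minPretentiousDistSq (twistChar g χ) Xb Xb := by
    intro Xb hXb1 hXb2
    have hsq : Real.sqrt X ≤ Xb := by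
      refine le_trans ?_ hXb1
      rw [le_div_iff₀ (by positivity)]
      calc Real.sqrt X * (4 * ((d * d₀ : ℕ) : ℝ) * W ^ 10) ≤ Real.sqrt X * (4 * W ^ 2 * W ^ 10) := by
            gcongr
        _ = Real.sqrt X * (4 * W ^ 12) := by ring
        _ ≤ Real.sqrt X * Real.sqrt X := by gcongr
        _ = X := Real.mul_self_sqrt hX0.le
        _ ≤ X₃ := hXX₃
    have hXb4 : 4 ≤ Xb := by
      have : (4 : ℝ) ≤ 4 * W ^ 12 := by nlinarith [one_le_pow₀ (n := 12) hW1]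
      linarith
    have := minPretentiousDistSq_twistChar_ge hg1 hq₀ χ hq₀W hXb4 hXb2 hsq
    rw [hMlow]; linarith
  -- apply the single-character estimate
  have hmain := h6 X X₃ W L (d * d₀) s' (twistChar g χ) Mlow (isMultiplicative_twistChar hg hg1' χ)
    (norm_twistChar_le hg1 χ) hXs hXX₃ hX₃ hW₀ hWX hd₁ hd₁W hWL hLX hLexp hlogL hs'low hs'up hMlow1 hMd
  -- rewrite heights and floors
  have e1 : X₃ / d / d₀ = X₃ / ((d * d₀ : ℕ) : ℝ) := by push_cast; rw [div_div]
  have e2 : ⌊X₃⌋₊ / d / d₀ = ⌊X₃ / ((d * d₀ : ℕ) : ℝ)⌋₊ := by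
    rw [Nat.floor_div_natCast, Nat.div_div_eq_div_mul]
  rw [e1, e2]
  refine hmain.trans ?_
  have hsq := sqrt_exp_neg_Mlow_le hW1 (by rw [hMlow] at hMlow1; linarith)
  have hX₃0 : 0 ≤ X₃ := by linarith
  have e3 : X₃ / ((d * d₀ : ℕ) : ℝ) = X₃ / (d * d₀) := by push_cast; ring
  rw [e3]
  have hpos : 0 ≤ C₆ * s' * (X₃ / (d * d₀)) := by positivity
  calc C₆ * s' * (X₃ / (d * d₀)) * (Real.sqrt ((1 + Mlow) * Real.exp (-Mlow)) + W ^ (-(5 : ℝ) / 4))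
      ≤ C₆ * s' * (X₃ / (d * d₀)) * (3 * Real.exp 24 * W ^ (-(5 : ℝ) / 4) + W ^ (-(5 : ℝ) / 4)) := by
        refine mul_le_mul_of_nonneg_left (add_le_add ?_ le_rfl) hpos
        rw [hMlow]; exact hsq
    _ = C₆ * (3 * Real.exp 24 + 1) * W ^ (-(5 : ℝ) / 4) * s' * (X₃ / (d * d₀)) := by ring

set_option maxHeartbeats 1600000 in
/-- **The major arc estimate** ([MRT2015, §4], the case `q ≤ W` of Proposition 2.4), discrete
form and with the `L²` minor-arc companion's normalisations: for `g` completely multiplicative and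
`1`-bounded with `M(g; X, W) ≥ 3 log W` (hypothesis (2-1)), `α = a/q + β` with `q ≤ W`,
`|β| ≤ W/(qL)`, scale `d < W`, heights `X ≤ X₃ ≤ 2X`, and the parameter regime of Theorem 2.3
(`W ≤ log^{1/125} X`; we also assume `L W^{15} ≤ X`, `L ≤ exp(√(log X/2))`, `(log L)⁵ ≤ W`,
`W^{203} ≤ L`, valid in the proof of Theorem 1.7),
`∑_{x ≤ X₃} |∑_{x < dm ≤ x + L, m ∈ 𝒮'} g(m) e(αm)| ≤ C L X₃ (W^{-2} + d^{-1} W^{-1/4})`,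
`𝒮' = 𝒮_{W^{200}, L/W³, √X₃, X₃/d}`.  Steps as printed: rescaling to windows of length
`⌊L/d⌋, ⌊L/d⌋+1`; removal of `e(βm)` by partial summation; windows shorter than `2L/W²` are trivial;
otherwise residue classes mod `q`, characters, and Theorem A.2 (`perChar_bound`).
[cite: MatomakiRadziwillTao2015, §4] -/
theorem majorArc_le (hA2 : MatomakiRadziwillTao2015_theoremA2) :
    ∃ C W₀ Xs : ℝ, 0 < C ∧ ∀ (X X₃ W : ℝ) (L d q : ℕ) (a : ℤ) (α : ℝ) (g : ArithmeticFunction ℂ),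
      (∀ m n : ℕ, g (m * n) = g m * g n) → g 1 = 1 → (∀ n, ‖g n‖ ≤ 1) →
      Xs ≤ X → X ≤ X₃ → X₃ ≤ 2 * X → W₀ ≤ W → W ≤ Real.log X ^ (1 / 125 : ℝ) →
      1 ≤ d → (d : ℝ) < W → 1 ≤ q → (q : ℝ) ≤ W → |α - a / q| ≤ W / (q * L) →
      W ^ 203 ≤ (L : ℝ) → (L : ℝ) * W ^ 15 ≤ X → (L : ℝ) ≤ Real.exp (Real.sqrt (Real.log X / 2)) →
      Real.log L ^ 5 ≤ W → 3 * Real.log W ≤ Sieve.nonpretentiousness g X W →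
      ∑ x ∈ range (⌊X₃⌋₊ + 1), ‖∑ m ∈ Ioc (x / d) ((x + L) / d),
          typFun g (W ^ 200) (L / W ^ 3) (Real.sqrt X₃) (X₃ / d) m * (𝐞 (α * m) : ℂ)‖ ≤
        C * L * X₃ * (1 / W ^ 2 + 1 / (d * W ^ (1 / 4 : ℝ))) := by
  obtain ⟨C₆, W₆, X₆, hC₆, h6⟩ := winL1_typical_le hA2
  set Cχ : ℝ := C₆ * (3 * Real.exp 24 + 1) with hCχ
  have hCχ0 : 0 < Cχ := by positivity
  refine ⟨8 + 16 * Cχ + 32 * π + 64 * π * Cχ, max W₆ (Real.exp 17), X₆, by positivity, ?_⟩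
  intro X X₃ W L d q a α g hg hg1' hg1 hXs hXX₃ hX₃ hW₀ hWX hd hdW hq hqW hβ hWL hLX hLexp hlogL hM
  -- basics
  have hW₆ : W₆ ≤ W := (le_max_left _ _).trans hW₀
  have hW17 : Real.exp 17 ≤ W := (le_max_right _ _).trans hW₀
  have hW18 : (18 : ℝ) ≤ W := le_trans (by have := Real.add_one_le_exp (17 : ℝ); linarith) hW17
  have hW1 : (1 : ℝ) ≤ W := by linarith
  have hW0 : 0 < W := by linarith
  have hd0 : (0 : ℝ) < d := by exact_mod_cast hd
  have hd1 : (1 : ℝ) ≤ d := by exact_mod_cast hd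
  have hq0 : (0 : ℝ) < q := by exact_mod_cast hq
  have hq1 : (1 : ℝ) ≤ q := by exact_mod_cast hq
  have hL1 : (1 : ℝ) ≤ L := le_trans (one_le_pow₀ hW1) hWL
  have hL0 : (0 : ℝ) < L := by linarith
  have hLW : W ≤ (L : ℝ) := le_trans (le_self_pow₀ hW1 (by norm_num)) hWL
  have hdL : (d : ℝ) ≤ L := (hdW.le).trans hLW
  have hX1 : (1 : ℝ) ≤ X := by
    have : (1 : ℝ) * 1 ≤ (L : ℝ) * W ^ 15 := mul_le_mul hL1 (one_le_pow₀ hW1) zero_le_one hL0.le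
    linarith
  have hXW : W ≤ X := by
    have : (1 : ℝ) * W ≤ (L : ℝ) * W ^ 15 :=
      mul_le_mul hL1 (le_self_pow₀ hW1 (by norm_num)) hW0.le hL0.le
    linarith
  have hX0 : 0 < X := by linarith
  have hX₃0 : 0 < X₃ := by linarith
  have hdX₃ : (d : ℝ) ≤ X₃ := by linarith [hdW.le]
  have hP : (1 : ℝ) < W ^ 200 := by
    calc (1 : ℝ) < W := by linarith
      _ ≤ W ^ 200 := le_self_pow₀ hW1 (by norm_num)
  have hqP : (q : ℝ) < W ^ 200 := lt_of_le_of_lt hqW (by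
    calc W = W ^ 1 := (pow_one W).symm
      _ < W ^ 200 := pow_lt_pow_right₀ (by linarith) (by norm_num))
  have hQ : 1 ≤ Real.log ((L : ℝ) / W ^ 3) := by
    have h1 : W ≤ (L : ℝ) / W ^ 3 := by
      rw [le_div_iff₀ (by positivity)]
      calc W * W ^ 3 = W ^ 4 := by ring
        _ ≤ W ^ 203 := pow_le_pow_right₀ hW1 (by norm_num)
        _ ≤ L := hWL
    have h2 : Real.exp 1 ≤ W := le_trans (Real.exp_le_exp.mpr (by norm_num)) hW17
    have := Real.log_le_log (Real.exp_pos 1) (h2.trans h1)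
    rwa [Real.log_exp] at this
  -- `W`-powers
  set v : ℝ := W ^ (1 / 4 : ℝ) with hv
  have hv0 : 0 < v := Real.rpow_pos_of_pos hW0 _
  have hvW : v ≤ W := by
    rw [hv]; calc W ^ (1 / 4 : ℝ) ≤ W ^ (1 : ℝ) := Real.rpow_le_rpow_of_exponent_le hW1 (by norm_num)
      _ = W := Real.rpow_one W
  have hK : W ^ (-(5 : ℝ) / 4) = 1 / (W * v) := by
    rw [hv, show (-(5 : ℝ) / 4) = -((5 : ℝ) / 4) by ring, Real.rpow_neg hW0.le,
      show ((5 : ℝ) / 4) = 1 + 1 / 4 by norm_num, Real.rpow_add hW0, Real.rpow_one, inv_eq_one_div]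
  set K : ℝ := Cχ * W ^ (-(5 : ℝ) / 4) with hKdef
  have hK0 : 0 ≤ K := by positivity
  -- the unit-scale family
  set Y : ℕ := ⌊X₃⌋₊ / d with hY
  have hYle : (Y : ℝ) ≤ X₃ / d := by
    rw [hY, le_div_iff₀ hd0]
    calc ((⌊X₃⌋₊ / d : ℕ) : ℝ) * d ≤ ⌊X₃⌋₊ := by exact_mod_cast Nat.div_mul_le_self _ _
      _ ≤ X₃ := Nat.floor_le hX₃0.le
  set c₀ : ℕ → ℂ := fun m =>
    typFun g (W ^ 200) (L / W ^ 3) (Real.sqrt X₃) (X₃ / d) m * (𝐞 ((a : ℝ) * m / q) : ℂ) with hc₀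
  have hc₀1 : ∀ m, ‖c₀ m‖ ≤ 1 := by
    intro m
    rw [hc₀]; dsimp only
    rw [norm_mul, norm_fourierChar, mul_one]
    exact norm_typFun_le hg1 _ _ _ _ m
  set Umax : ℝ := 4 * L * X₃ / (d * W ^ 2) + 8 * q * K * L * X₃ / (d : ℝ) ^ 2 with hUmax
  have hUmax0 : 0 ≤ Umax := by positivity
  have hU : ∀ j : ℕ, (j : ℝ) ≤ 2 * L / d + 1 → winL1 c₀ j Y ≤ Umax := by
    intro j hj
    by_cases hjs : (j : ℝ) ≤ 2 * L / W ^ 2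
    · -- short windows: trivial bound
      have h1 := winL1_le_trivial hc₀1 j Y
      refine h1.trans ?_
      have h2 : ((Y : ℝ) + 1) * j ≤ 4 * L * X₃ / (d * W ^ 2) := by
        calc ((Y : ℝ) + 1) * j ≤ (X₃ / d + X₃ / d) * (2 * L / W ^ 2) := by
              refine mul_le_mul (add_le_add hYle ?_) hjs (Nat.cast_nonneg j) (by positivity)
              rw [le_div_iff₀ hd0, one_mul]; exact hdX₃
          _ = 4 * L * X₃ / (d * W ^ 2) := by field_simp; ring
      have h3 : 0 ≤ 8 * q * K * L * X₃ / (d : ℝ) ^ 2 := by positivity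
      rw [hUmax]; linarith
    · -- long windows: residue classes and Theorem A.2
      rw [not_le] at hjs
      have hper := perChar_bound hC₆ h6 hg hg1' hg1 hXs hXX₃ hX₃ hW₆ hW17 hWX hd hdW hqW hWL hLX
        hLexp hlogL hM hjs hj
      have h2 := unitScale_class_le hg hg1 hP hQ hX₃0.le hK0 hq hqP hd a hper
      refine h2.trans ?_
      have h3 : 2 * (j : ℝ) + 2 ≤ 8 * L / d := by
        have : (1 : ℝ) ≤ L / d := by rw [le_div_iff₀ hd0, one_mul]; exact hdL
        have e : 2 * (L : ℝ) / d = 2 * (L / d) := by ring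
        rw [e] at hj
        have e2 : 8 * (L : ℝ) / d = 8 * (L / d) := by ring
        rw [e2]; linarith
      have h4 : (q : ℝ) * K * X₃ * (2 * j + 2) / d ≤ (q : ℝ) * K * X₃ * (8 * L / d) / d :=
        div_le_div_of_nonneg_right (mul_le_mul_of_nonneg_left h3 (by positivity)) hd0.le
      refine h4.trans ?_
      have e : (q : ℝ) * K * X₃ * (8 * L / d) / d = 8 * q * K * L * X₃ / (d : ℝ) ^ 2 := by
        field_simp
      rw [e, hUmax]
      have : 0 ≤ 4 * (L : ℝ) * X₃ / (d * W ^ 2) := by positivity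
      linarith
  -- the two rescaled window lengths, with the twist removed
  set β : ℝ := α - a / q with hβdef
  have hfun : (fun m : ℕ => typFun g (W ^ 200) (L / W ^ 3) (Real.sqrt X₃) (X₃ / d) m * (𝐞 (α * m) : ℂ)) =
      fun m : ℕ => c₀ m * (𝐞 (β * m) : ℂ) := by
    funext m
    rw [hc₀]; dsimp only
    rw [mul_assoc, fourierChar_mul_fourierChar]
    congr 2
    rw [hβdef]; ring
  have hB : |β| ≤ W / (q * L) := hβ
  have hA : ∀ t : ℕ, (t : ℝ) ≤ L / d + 1 →
      winL1 (fun m : ℕ => c₀ m * (𝐞 (β * m) : ℂ)) t Y ≤ Umax * (1 + 4 * π * W / (q * d)) := by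
    intro t ht
    have h1 := winL1_twist_le c₀ hB t Y
    refine h1.trans ?_
    have ht2 : (t : ℝ) ≤ 2 * L / d := by
      have : (1 : ℝ) ≤ L / d := by rw [le_div_iff₀ hd0, one_mul]; exact hdL
      have e : 2 * (L : ℝ) / d = L / d + L / d := by ring
      rw [e]; linarith
    have hUt : winL1 c₀ t Y ≤ Umax := hU t (by linarith)
    have hsum : ∑ j ∈ range t, winL1 c₀ j Y ≤ t * Umax := by
      calc ∑ j ∈ range t, winL1 c₀ j Y ≤ ∑ j ∈ range t, Umax := by
            refine Finset.sum_le_sum fun j hj => hU j ?_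
            have : (j : ℝ) < t := by exact_mod_cast Finset.mem_range.mp hj
            linarith
        _ = t * Umax := by rw [Finset.sum_const, card_range, nsmul_eq_mul]
    have hWqL : 0 ≤ W / (q * L) := by positivity
    calc winL1 c₀ t Y + 2 * π * (W / (q * L)) * ∑ j ∈ range t, winL1 c₀ j Y
        ≤ Umax + 2 * π * (W / (q * L)) * (t * Umax) := by
          have := mul_le_mul_of_nonneg_left hsum (show 0 ≤ 2 * π * (W / (q * L)) by positivity)
          linarith
      _ ≤ Umax + 2 * π * (W / (q * L)) * (2 * L / d * Umax) := by
          have := mul_le_mul_of_nonneg_right ht2 hUmax0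
          have := mul_le_mul_of_nonneg_left this (show 0 ≤ 2 * π * (W / (q * L)) by positivity)
          linarith
      _ = Umax * (1 + 4 * π * W / (q * d)) := by field_simp; ring
  -- rescaling by `d`
  have hresc := sum_norm_win_div_le (fun m : ℕ => c₀ m * (𝐞 (β * m) : ℂ)) hd L ⌊X₃⌋₊
  rw [hfun]
  refine hresc.trans ?_
  have hLd : (((L / d : ℕ) : ℝ)) ≤ L / d := Nat.cast_div_le
  have hA1 := hA (L / d) (by linarith)
  have hA2' := hA (L / d + 1) (by push_cast; linarith)
  have htot : (d : ℝ) * (winL1 (fun m : ℕ => c₀ m * (𝐞 (β * m) : ℂ)) (L / d) (⌊X₃⌋₊ / d) +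
      winL1 (fun m : ℕ => c₀ m * (𝐞 (β * m) : ℂ)) (L / d + 1) (⌊X₃⌋₊ / d)) ≤
      d * (2 * (Umax * (1 + 4 * π * W / (q * d)))) := by
    refine mul_le_mul_of_nonneg_left ?_ hd0.le
    rw [← hY]; linarith
  refine htot.trans ?_
  -- final numerics
  rw [hUmax, hKdef, hK]
  have hT2 : (d : ℝ) * (2 * ((8 * q * (Cχ * (1 / (W * v))) * L * X₃ / (d : ℝ) ^ 2) * 1)) ≤
      16 * Cχ * L * X₃ / (d * v) := by
    have e : (d : ℝ) * (2 * ((8 * q * (Cχ * (1 / (W * v))) * L * X₃ / (d : ℝ) ^ 2) * 1)) =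
        16 * Cχ * L * X₃ / (d * v) * (q / W) := by field_simp; ring
    rw [e]
    have hqW' : (q : ℝ) / W ≤ 1 := (div_le_one hW0).mpr hqW
    have h0 : 0 ≤ 16 * Cχ * L * X₃ / (d * v) := by positivity
    nlinarith
  have hT3 : (d : ℝ) * (2 * ((4 * L * X₃ / (d * W ^ 2)) * (4 * π * W / (q * d)))) ≤
      32 * π * L * X₃ / (d * v) := by
    have e : (d : ℝ) * (2 * ((4 * L * X₃ / (d * W ^ 2)) * (4 * π * W / (q * d)))) =
        32 * π * L * X₃ / (d * v) * (v / (q * W)) := by field_simp; ring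
    rw [e]
    have h1 : v / (q * W) ≤ 1 := by
      rw [div_le_one (by positivity)]
      calc v ≤ W := hvW
        _ = 1 * W := (one_mul W).symm
        _ ≤ q * W := mul_le_mul_of_nonneg_right hq1 hW0.le
    have h0 : 0 ≤ 32 * π * L * X₃ / (d * v) := by positivity
    nlinarith
  have hT4 : (d : ℝ) * (2 * ((8 * q * (Cχ * (1 / (W * v))) * L * X₃ / (d : ℝ) ^ 2) * (4 * π * W / (q * d)))) ≤
      64 * π * Cχ * L * X₃ / (d * v) := by
    have e : (d : ℝ) * (2 * ((8 * q * (Cχ * (1 / (W * v))) * L * X₃ / (d : ℝ) ^ 2) * (4 * π * W / (q * d)))) =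
        64 * π * Cχ * L * X₃ / (d * v) * (1 / d) := by field_simp; ring
    rw [e]
    have h1 : 1 / (d : ℝ) ≤ 1 := (div_le_one hd0).mpr hd1
    have h0 : 0 ≤ 64 * π * Cχ * L * X₃ / (d * v) := by positivity
    nlinarith
  have hT1 : (d : ℝ) * (2 * ((4 * L * X₃ / (d * W ^ 2)) * 1)) = 8 * L * X₃ / W ^ 2 := by
    field_simp; ring
  -- expand the product
  have e : (d : ℝ) * (2 * ((4 * L * X₃ / (d * W ^ 2) + 8 * q * (Cχ * (1 / (W * v))) * L * X₃ / (d : ℝ) ^ 2) *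
      (1 + 4 * π * W / (q * d)))) =
      (d : ℝ) * (2 * ((4 * L * X₃ / (d * W ^ 2)) * 1)) +
      (d : ℝ) * (2 * ((8 * q * (Cχ * (1 / (W * v))) * L * X₃ / (d : ℝ) ^ 2) * 1)) +
      (d : ℝ) * (2 * ((4 * L * X₃ / (d * W ^ 2)) * (4 * π * W / (q * d)))) +
      (d : ℝ) * (2 * ((8 * q * (Cχ * (1 / (W * v))) * L * X₃ / (d : ℝ) ^ 2) * (4 * π * W / (q * d)))) := by
    ring
  rw [e, hT1]
  have hgoal : 8 * (L : ℝ) * X₃ / W ^ 2 + 16 * Cχ * L * X₃ / (d * v) + 32 * π * L * X₃ / (d * v) +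
      64 * π * Cχ * L * X₃ / (d * v) ≤
      (8 + 16 * Cχ + 32 * π + 64 * π * Cχ) * L * X₃ * (1 / W ^ 2 + 1 / (d * v)) := by
    have h1 : 0 ≤ (L : ℝ) * X₃ / W ^ 2 := by positivity
    have h2 : 0 ≤ (L : ℝ) * X₃ / (d * v) := by positivity
    have e2 : (8 + 16 * Cχ + 32 * π + 64 * π * Cχ) * L * X₃ * (1 / W ^ 2 + 1 / (d * v)) =
        (8 + 16 * Cχ + 32 * π + 64 * π * Cχ) * (L * X₃ / W ^ 2) +
        (8 + 16 * Cχ + 32 * π + 64 * π * Cχ) * (L * X₃ / (d * v)) := by ring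
    rw [e2]
    have e3 : 8 * (L : ℝ) * X₃ / W ^ 2 + 16 * Cχ * L * X₃ / (d * v) + 32 * π * L * X₃ / (d * v) +
        64 * π * Cχ * L * X₃ / (d * v) =
        8 * (L * X₃ / W ^ 2) + (16 * Cχ + 32 * π + 64 * π * Cχ) * (L * X₃ / (d * v)) := by ring
    rw [e3]
    have hπ : 0 ≤ π := Real.pi_pos.le
    nlinarith [mul_nonneg hCχ0.le h1, mul_nonneg hπ h1, mul_nonneg (mul_nonneg hπ hCχ0.le) h1,
      mul_nonneg hCχ0.le h2]
  linarith

end MRT2015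

end Literature.NumberTheory.LFunctions
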